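import Mathlib
import Literature.Combinatorics.Optimization.OnePointUnionWalks
import HarnessLib

/-!
# Multicut distributions on path-decomposable graphs (Charikar–Makarychev–Makarychev 2010,
# Theorem 3.3 and Lemma 3.4; = CMM09 Theorem 2.4)

[topic Combinatorics/Optimization]

Fifth file of the formalisation of the Charikar–Makarychev–Makarychev Sherali–Adams gap for
MAX-CUT (the tree's `CharikarMakarychevMakarychev2009_maxCutSA`).  CMM10 Theorem 3.3 (p. 16):

> **Theorem 3.3.** "Suppose `G = (V, E)` is an `l`-path decomposable graph. Let `d(·,·)` be the
> shortest path distance on `G`, and `L = ⌊l/9⌋`; `µ ∈ [1/L, 1]`. Then there exists a probabilistic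
> distribution of multicuts of `G` … such that … 1. If `d(u, v) ≤ L`, then the probability that `u`
> and `v` are separated by the multicut equals `1 − (1 − µ)^{d(u,v)}`; moreover, if `u` and `v` lie in
> the same part, then the unique shortest path between `u` and `v` also lies in that part. 2. If
> `d(u, v) > L`, then the probability that `u` and `v` are separated by the multicut is at least
> `1 − (1 − µ)^L`. 3. Every piece of the multicut partition is a tree."

Here a multicut is a set `S ⊆ E` of removed edges, a distribution of multicuts is a probability
vector `p` on `Finset (Sym2 V)`, "`u, v` not separated" is reachability in `gr (E ∖ S)`, and the three
conditions are the fields of `GoodMulticut µ L E p` (condition 1 split into the probability identity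
`exact` and the shortest-path clause `geodesic`, stated as `d_{E∖S}(u,v) = d_E(u,v)`).  This file
proves the INDUCTIVE STEPS of the printed proof (p. 17–18) and Lemma 3.4 (p. 16–17):

* base cases (`GoodMulticut.empty`, `GoodMulticut.singleton`: "If `G` consists of two vertices
  connected by an edge then let `S` contain this edge with probability `µ`");
* **case 1/2, one-point unions** (`GoodMulticut.union`): independent union of the multicuts of two
  edge sets whose supports meet in at most one vertex (`prodU`, "Let `S = ∪ S_i`, where all `S_i` are
  drawn independently"), with the separation probabilities computed exactly as printed
  ("`Pr(S separates u and v) = 1 − (1 − Pr(S_i separates u and c))(1 − Pr(S_j separates c and v))`");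
* **Lemma 3.4, paths** (`GoodMulticut.path`): the coupled coin distribution on a path of length
  `m ≥ 3L` ("all decisions for `P₁` and `P₂` are independent; all decisions for `P₂` and `P₃` are
  independent; we add to `S` at least one edge either from `P₁` or from `P₃`"), with an explicit
  coupling density (`coupling`), under `(1 − µ)^L ≤ 1/2` (printed: `µ ≥ 1/L`, giving
  `(1−µ)^L ≤ 1/e`);
* **case 3, attached paths** (`GoodMulticut.ear`): a good distribution on `H` and three always-cut
  path pieces give a good distribution on `H ∪ P`;
* **Theorem 3.3** (`exists_goodMulticut`): by induction on the number of edges, every loopless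
  edge set that is `l`-path decomposable in the hereditary form `PathDecomposable l E` (Def. 3.2
  rendered as: every non-separable sub-edge-set with `≥ 2` edges contains an attached path of
  length `≥ l`) carries a `GoodMulticut µ L E p`, for `9L ≤ l`, `0 ≤ µ ≤ 1`, `(1 − µ)^L ≤ 1/2`.

The `±1`-process corollary (CMM09 Cor. 5.1, local correlation matrices) is in the sequel.
Everything is proved; no named facts.

## References

* [CharikarMakarychevMakarychev2010] M. Charikar, K. Makarychev, Y. Makarychev, *Local global
  tradeoffs in metric embeddings*, SIAM J. Comput. 39 (2010) 2487–2512, doi:10.1137/070712080;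
  Thm 3.3, Lemma 3.4 and their proofs (p. 16–18).  Held text `paper:doi-10-1137-070712080`.
* [CharikarMakarychevMakarychev2009] M. Charikar, K. Makarychev, Y. Makarychev, *Integrality gaps for
  Sherali–Adams relaxations*, STOC 2009, doi:10.1145/1536414.1536455; Thm 2.4 (p. 5).
-/

noncomputable section

open Finset SimpleGraph

namespace Literature.Combinatorics.Optimization

namespace Multicut

variable {V : Type*} [Fintype V] [DecidableEq V]

/-! ### Distributions of multicuts -/

open Classical in
/-- The indicator that `u` and `v` are NOT separated after removing `S` from `E` (they lie in the
same piece of `E ∖ S`). [cite: CharikarMakarychevMakarychev2010, Thm 3.3 (p. 16)] -/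
def jind (Z : Finset (Sym2 V)) (u v : V) : ℝ := if (gr Z).Reachable u v then 1 else 0

/-- `jind` is `0` or `1`: nonnegative. [cite: CharikarMakarychevMakarychev2010, Thm 3.3 (p. 16)] -/
theorem jind_nonneg (Z : Finset (Sym2 V)) (u v : V) : 0 ≤ jind Z u v := by
  unfold jind; split_ifs <;> norm_num

/-- `jind ≤ 1`. [cite: CharikarMakarychevMakarychev2010, Thm 3.3 (p. 16)] -/
theorem jind_le_one (Z : Finset (Sym2 V)) (u v : V) : jind Z u v ≤ 1 := by
  unfold jind; split_ifs <;> norm_num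

/-- `jind` of a reachable pair. [cite: CharikarMakarychevMakarychev2010, Thm 3.3 (p. 16)] -/
theorem jind_of_reachable {Z : Finset (Sym2 V)} {u v : V} (h : (gr Z).Reachable u v) : jind Z u v = 1 := by
  unfold jind; rw [if_pos h]

/-- `jind` of a separated pair. [cite: CharikarMakarychevMakarychev2010, Thm 3.3 (p. 16)] -/
theorem jind_of_not_reachable {Z : Finset (Sym2 V)} {u v : V} (h : ¬ (gr Z).Reachable u v) :
    jind Z u v = 0 := by
  unfold jind; rw [if_neg h]

/-- `jind` is symmetric. [cite: CharikarMakarychevMakarychev2010, Thm 3.3 (p. 16)] -/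
theorem jind_comm (Z : Finset (Sym2 V)) (u v : V) : jind Z u v = jind Z v u := by
  unfold jind
  simp only [SimpleGraph.reachable_comm]

/-- `jind u u = 1`. [cite: CharikarMakarychevMakarychev2010, Thm 3.3 (p. 16)] -/
theorem jind_self (Z : Finset (Sym2 V)) (u : V) : jind Z u u = 1 := jind_of_reachable (Reachable.refl _)

/-- `jind` only depends on the reachability predicate. [cite: CharikarMakarychevMakarychev2010, Thm 3.3 (p. 16)] -/
theorem jind_congr {Z Z' : Finset (Sym2 V)} {u v u' v' : V}
    (h : (gr Z).Reachable u v ↔ (gr Z').Reachable u' v') : jind Z u v = jind Z' u' v' := by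
  unfold jind
  by_cases h' : (gr Z).Reachable u v
  · rw [if_pos h', if_pos (h.1 h')]
  · rw [if_neg h', if_neg fun h'' => h' (h.2 h'')]

/-- `jind` of a conjunction of two reachabilities is the product. [cite: CharikarMakarychevMakarychev2010, Thm 3.3 proof, case 2 (p. 17)] -/
theorem jind_eq_mul {Z Z₁ Z₂ : Finset (Sym2 V)} {u v u₁ v₁ u₂ v₂ : V}
    (h : (gr Z).Reachable u v ↔ (gr Z₁).Reachable u₁ v₁ ∧ (gr Z₂).Reachable u₂ v₂) :
    jind Z u v = jind Z₁ u₁ v₁ * jind Z₂ u₂ v₂ := by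
  unfold jind
  by_cases h₁ : (gr Z₁).Reachable u₁ v₁ <;> by_cases h₂ : (gr Z₂).Reachable u₂ v₂ <;>
    by_cases h' : (gr Z).Reachable u v <;> simp_all

/-- **The probability that `u` and `v` are not separated** by the random multicut `p` of `E`.
[cite: CharikarMakarychevMakarychev2010, Thm 3.3 (p. 16)] -/
def jointProb (p : Finset (Sym2 V) → ℝ) (E : Finset (Sym2 V)) (u v : V) : ℝ :=
  ∑ S, p S * jind (E \ S) u v

/-- `jointProb` is symmetric in the vertices. [cite: CharikarMakarychevMakarychev2010, Thm 3.3 (p. 16)] -/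
theorem jointProb_comm (p : Finset (Sym2 V) → ℝ) (E : Finset (Sym2 V)) (u v : V) :
    jointProb p E u v = jointProb p E v u := by
  unfold jointProb; simp_rw [jind_comm _ u v]

/-- **The independent union of two multicut distributions**: `S = S₁ ∪ S₂` with `S₁ ∼ p`, `S₂ ∼ q`
independent. [cite: CharikarMakarychevMakarychev2010, Thm 3.3 proof (p. 17: "Let S = ∪_i S_i, where all S_i are drawn independently")] -/
def prodU (p q : Finset (Sym2 V) → ℝ) : Finset (Sym2 V) → ℝ :=
  fun S => ∑ S₁, ∑ S₂, if S₁ ∪ S₂ = S then p S₁ * q S₂ else 0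

/-- **Expectations under the independent union**: `E_{p⊗q} f = Σ_{S₁,S₂} p(S₁) q(S₂) f(S₁ ∪ S₂)`.
[cite: CharikarMakarychevMakarychev2010, Thm 3.3 proof (p. 17)] -/
theorem sum_prodU_mul (p q : Finset (Sym2 V) → ℝ) (f : Finset (Sym2 V) → ℝ) :
    ∑ S, prodU p q S * f S = ∑ S₁, ∑ S₂, p S₁ * q S₂ * f (S₁ ∪ S₂) := by
  unfold prodU
  simp_rw [Finset.sum_mul]
  rw [Finset.sum_comm]
  refine Finset.sum_congr rfl fun S₁ _ => ?_
  rw [Finset.sum_comm]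
  refine Finset.sum_congr rfl fun S₂ _ => ?_
  simp_rw [ite_mul, zero_mul]
  rw [Finset.sum_ite_eq]
  simp

/-- The independent union has total mass `1`. [cite: CharikarMakarychevMakarychev2010, Thm 3.3 proof (p. 17)] -/
theorem sum_prodU (p q : Finset (Sym2 V) → ℝ) (hp : ∑ S, p S = 1) (hq : ∑ S, q S = 1) :
    ∑ S, prodU p q S = 1 := by
  have := sum_prodU_mul p q (fun _ => 1)
  simp only [mul_one] at this
  rw [this]
  simp_rw [← Finset.mul_sum, hq, mul_one, hp]

/-- The independent union is nonnegative. [cite: CharikarMakarychevMakarychev2010, Thm 3.3 proof (p. 17)] -/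
theorem prodU_nonneg {p q : Finset (Sym2 V) → ℝ} (hp : ∀ S, 0 ≤ p S) (hq : ∀ S, 0 ≤ q S)
    (S : Finset (Sym2 V)) : 0 ≤ prodU p q S :=
  Finset.sum_nonneg fun S₁ _ => Finset.sum_nonneg fun S₂ _ => by
    split_ifs
    · exact mul_nonneg (hp S₁) (hq S₂)
    · exact le_rfl

/-- Support of the independent union. [cite: CharikarMakarychevMakarychev2010, Thm 3.3 proof (p. 17)] -/
theorem exists_of_prodU_ne_zero {p q : Finset (Sym2 V) → ℝ} {S : Finset (Sym2 V)}
    (h : prodU p q S ≠ 0) : ∃ S₁ S₂, S₁ ∪ S₂ = S ∧ p S₁ ≠ 0 ∧ q S₂ ≠ 0 := by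
  obtain ⟨S₁, -, h₁⟩ := Finset.exists_ne_zero_of_sum_ne_zero h
  obtain ⟨S₂, -, h₂⟩ := Finset.exists_ne_zero_of_sum_ne_zero h₁
  split_ifs at h₂ with hS
  · exact ⟨S₁, S₂, hS, left_ne_zero_of_mul h₂, right_ne_zero_of_mul h₂⟩
  · exact absurd rfl h₂

/-- The independent union is commutative. [cite: CharikarMakarychevMakarychev2010, Thm 3.3 proof (p. 17)] -/
theorem prodU_comm (p q : Finset (Sym2 V) → ℝ) : prodU p q = prodU q p := by
  funext S
  unfold prodU
  rw [Finset.sum_comm]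
  refine Finset.sum_congr rfl fun S₁ _ => Finset.sum_congr rfl fun S₂ _ => ?_
  rw [union_comm, mul_comm]

/-- A sum weighted by `p` only sees the support of `p`. [folklore] -/
private theorem sum_mul_congr_support {ι : Type*} (s : Finset ι) (p f g : ι → ℝ)
    (h : ∀ i ∈ s, p i ≠ 0 → f i = g i) : ∑ i ∈ s, p i * f i = ∑ i ∈ s, p i * g i :=
  Finset.sum_congr rfl fun i hi => by
    by_cases hp : p i = 0
    · rw [hp, zero_mul, zero_mul]
    · rw [h i hi hp]

/-! ### Good multicut distributions (the conclusion of Theorem 3.3) -/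

/-- **The conclusion of CMM10 Theorem 3.3 for the edge set `E`, cut parameter `µ` and radius `L`:**
`p` is a probability vector on multicuts `S ⊆ E` such that (3) every `E ∖ S` in the support is a
forest; (1) if `d_E(u,v) = k ≤ L` then `Pr[u, v not separated] = (1−µ)^k`, and whenever `u, v` are
not separated their distance inside their piece is `d_E(u,v)` (the shortest path survives); (2) if
`d_E(u,v) > L` (including `∞`) then `Pr[u, v not separated] ≤ (1−µ)^L`.
[cite: CharikarMakarychevMakarychev2010, Thm 3.3 (p. 16)] -/
structure GoodMulticut (μ : ℝ) (L : ℕ) (E : Finset (Sym2 V)) (p : Finset (Sym2 V) → ℝ) : Prop where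
  nonneg : ∀ S, 0 ≤ p S
  total : ∑ S, p S = 1
  subset : ∀ S, p S ≠ 0 → S ⊆ E
  acyclic : ∀ S, p S ≠ 0 → (gr (E \ S)).IsAcyclic
  exact : ∀ (u v : V) (k : ℕ), (gr E).edist u v = k → k ≤ L → jointProb p E u v = (1 - μ) ^ k
  geodesic : ∀ (S : Finset (Sym2 V)) (u v : V), p S ≠ 0 → (gr E).edist u v ≤ L →
    (gr (E \ S)).Reachable u v → (gr (E \ S)).edist u v = (gr E).edist u v
  far : ∀ u v : V, (L : ℕ∞) < (gr E).edist u v → jointProb p E u v ≤ (1 - μ) ^ L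

namespace GoodMulticut

variable {μ : ℝ} {L : ℕ} {E : Finset (Sym2 V)} {p : Finset (Sym2 V) → ℝ}

/-- `Pr[not separated] ≥ 0`. [cite: CharikarMakarychevMakarychev2010, Thm 3.3 (p. 16)] -/
theorem jointProb_nonneg (h : GoodMulticut μ L E p) (u v : V) : 0 ≤ jointProb p E u v :=
  Finset.sum_nonneg fun S _ => mul_nonneg (h.nonneg S) (jind_nonneg _ _ _)

/-- `Pr[not separated] ≤ 1`. [cite: CharikarMakarychevMakarychev2010, Thm 3.3 (p. 16)] -/
theorem jointProb_le_one (h : GoodMulticut μ L E p) (u v : V) : jointProb p E u v ≤ 1 := by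
  calc jointProb p E u v ≤ ∑ S, p S * 1 :=
        Finset.sum_le_sum fun S _ => mul_le_mul_of_nonneg_left (jind_le_one _ _ _) (h.nonneg S)
    _ = 1 := by simp [h.total]

/-- `Pr[u not separated from u] = 1`. [cite: CharikarMakarychevMakarychev2010, Thm 3.3 (p. 16)] -/
theorem jointProb_self (h : GoodMulticut μ L E p) (u : V) : jointProb p E u u = 1 := by
  simp [jointProb, jind_self, h.total]

/-- A uniform bound: `Pr[not separated] ≤ (1−µ)^{min(d,L)}`-type estimate in the form used for
far pairs: if `d_E(u,v) = k ≤ L` then `Pr ≤ (1−µ)^k`. [cite: CharikarMakarychevMakarychev2010, Thm 3.3 (p. 16)] -/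
theorem jointProb_le_pow_of_eq (h : GoodMulticut μ L E p) {u v : V} {k : ℕ}
    (hk : (gr E).edist u v = k) (hkL : k ≤ L) : jointProb p E u v ≤ (1 - μ) ^ k :=
  (h.exact u v k hk hkL).le

end GoodMulticut

/-! ### Base cases -/

/-- The point mass at the empty multicut. [cite: CharikarMakarychevMakarychev2010, Thm 3.3 proof, base case (p. 17)] -/
def dirac (S₀ : Finset (Sym2 V)) : Finset (Sym2 V) → ℝ := fun S => if S = S₀ then 1 else 0

/-- Expectation under a point mass. [cite: CharikarMakarychevMakarychev2010, Thm 3.3 proof, base case (p. 17)] -/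
theorem sum_dirac_mul (S₀ : Finset (Sym2 V)) (f : Finset (Sym2 V) → ℝ) :
    ∑ S, dirac S₀ S * f S = f S₀ := by
  simp [dirac, ite_mul]

/-- **Base case: no edges.**  Every pair `u ≠ v` is at distance `∞` and never joined.
[cite: CharikarMakarychevMakarychev2010, Thm 3.3 proof, base case (p. 17: "a vertex or an edge")] -/
theorem GoodMulticut.empty {μ : ℝ} (hμ : μ ≤ 1) (L : ℕ) :
    GoodMulticut μ L (∅ : Finset (Sym2 V)) (dirac ∅) where
  nonneg S := by unfold dirac; split_ifs <;> norm_num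
  total := by simpa using sum_dirac_mul (V := V) ∅ (fun _ => 1)
  subset S hS := by
    unfold dirac at hS; split_ifs at hS with h
    · subst h; exact Subset.rfl
    · exact absurd rfl hS
  acyclic S _ := by
    rw [Finset.empty_sdiff]; exact isAcyclic_gr_empty
  exact u v k hk hkL := by
    unfold jointProb
    rw [sum_dirac_mul, Finset.empty_sdiff]
    by_cases huv : u = v
    · subst huv
      rw [SimpleGraph.edist_self] at hk
      have : k = 0 := by exact_mod_cast hk.symm
      subst this
      simp [jind_self]
    · have hnr : ¬ (gr (∅ : Finset (Sym2 V))).Reachable u v := fun h =>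
        huv (eq_of_reachable_of_notMem_supp (by simp [mem_supp]) h)
      rw [edist_eq_top_of_not_reachable hnr] at hk
      exact absurd hk (by simp)
  geodesic S u v _ _ _ := by rw [Finset.empty_sdiff]
  far u v hfar := by
    unfold jointProb
    rw [sum_dirac_mul, Finset.empty_sdiff]
    by_cases huv : u = v
    · subst huv
      simp at hfar
    · rw [jind_of_not_reachable fun h => huv (eq_of_reachable_of_notMem_supp (by simp [mem_supp]) h)]
      exact pow_nonneg (by linarith) _

/-- **Base case: a single edge** `e = {x,y}`: cut it with probability `µ`.
[cite: CharikarMakarychevMakarychev2010, Thm 3.3 proof, base case (p. 17: "let S contain this edge with probability µ")] -/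
theorem GoodMulticut.singleton {μ : ℝ} (hμ0 : 0 ≤ μ) (hμ1 : μ ≤ 1) (L : ℕ) {x y : V} (hxy : x ≠ y) :
    GoodMulticut μ L ({s(x, y)} : Finset (Sym2 V))
      (fun S => μ * dirac {s(x, y)} S + (1 - μ) * dirac ∅ S) := by
  have hsum : ∀ f : Finset (Sym2 V) → ℝ,
      ∑ S, (μ * dirac {s(x, y)} S + (1 - μ) * dirac ∅ S) * f S = μ * f {s(x, y)} + (1 - μ) * f ∅ := by
    intro f
    simp_rw [add_mul, Finset.sum_add_distrib, mul_assoc, ← Finset.mul_sum, sum_dirac_mul]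
  -- the graph: `x ~ y` only
  have hreach : ∀ u v : V, (gr ({s(x, y)} : Finset (Sym2 V))).Reachable u v →
      u = v ∨ (u = x ∧ v = y) ∨ (u = y ∧ v = x) := by
    intro u v h
    by_cases huv : u = v
    · exact Or.inl huv
    · have hu := mem_supp_of_reachable_ne h huv
      have hv := mem_supp_of_reachable_ne h.symm (Ne.symm huv)
      simp only [mem_supp, Finset.mem_singleton, exists_eq_left, Sym2.mem_iff] at hu hv
      rcases hu with rfl | rfl <;> rcases hv with rfl | rfl <;> simp_all
  have hadj : (gr ({s(x, y)} : Finset (Sym2 V))).Adj x y := gr_adj.2 ⟨Finset.mem_singleton_self _, hxy⟩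
  have hedist_xy : (gr ({s(x, y)} : Finset (Sym2 V))).edist x y = 1 := edist_eq_one_iff_adj.2 hadj
  have hempty : ∀ u v : V, u ≠ v → ¬ (gr (∅ : Finset (Sym2 V))).Reachable u v := fun u v huv h =>
    huv (eq_of_reachable_of_notMem_supp (by simp [mem_supp]) h)
  have herase : ({s(x, y)} : Finset (Sym2 V)) \ {s(x, y)} = ∅ := by simp
  refine ⟨fun S => ?_, ?_, fun S hS => ?_, fun S hS => ?_, fun u v k hk hkL => ?_,
    fun S u v hS hd hr => ?_, fun u v hfar => ?_⟩
  · exact add_nonneg (mul_nonneg hμ0 (by unfold dirac; split_ifs <;> norm_num))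
      (mul_nonneg (by linarith) (by unfold dirac; split_ifs <;> norm_num))
  · have := hsum fun _ => 1; simpa using this
  · -- support: `S = {e}` or `S = ∅`
    unfold dirac at hS
    by_cases h1 : S = {s(x, y)}
    · rw [h1]
    · by_cases h2 : S = ∅
      · rw [h2]; exact Finset.empty_subset _
      · simp [h1, h2] at hS
  · unfold dirac at hS
    by_cases h1 : S = {s(x, y)}
    · rw [h1, herase]; exact isAcyclic_gr_empty
    · by_cases h2 : S = ∅
      · rw [h2, Finset.sdiff_empty]; exact isAcyclic_gr_singleton _
      · simp [h1, h2] at hS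
  · -- exact probabilities
    unfold jointProb
    rw [hsum, herase, Finset.sdiff_empty]
    rcases hreach u v (reachable_of_edist_ne_top (by rw [hk]; exact ENat.coe_ne_top k)) with
      rfl | ⟨rfl, rfl⟩ | ⟨rfl, rfl⟩
    · rw [SimpleGraph.edist_self] at hk
      have : k = 0 := by exact_mod_cast hk.symm
      subst this
      simp [jind_self]
    · rw [hedist_xy] at hk
      have : k = 1 := by exact_mod_cast hk.symm
      subst this
      rw [jind_of_not_reachable (hempty _ _ hxy), jind_of_reachable hadj.reachable]
      ring
    · rw [SimpleGraph.edist_comm, hedist_xy] at hk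
      have : k = 1 := by exact_mod_cast hk.symm
      subst this
      rw [jind_of_not_reachable (hempty _ _ (Ne.symm hxy)), jind_of_reachable hadj.symm.reachable]
      ring
  · -- geodesics: the only nontrivial joined pairs are in `S = ∅`
    unfold dirac at hS
    by_cases h1 : S = {s(x, y)}
    · subst h1
      rw [herase] at hr ⊢
      rcases hreach u v (hr.mono (gr_mono (Finset.empty_subset _))) with rfl | ⟨rfl, rfl⟩ | ⟨rfl, rfl⟩
      · simp
      · exact absurd hr (hempty _ _ hxy)
      · exact absurd hr (hempty _ _ (Ne.symm hxy))
    · by_cases h2 : S = ∅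
      · subst h2; rw [Finset.sdiff_empty]
      · simp [h1, h2] at hS
  · -- far pairs: for `L = 0` the bound is `1`; for `L ≥ 1` far pairs are never joined
    unfold jointProb
    rw [hsum, herase, Finset.sdiff_empty]
    by_cases hL : L = 0
    · subst hL
      rw [pow_zero]
      calc μ * jind ∅ u v + (1 - μ) * jind {s(x, y)} u v ≤ μ * 1 + (1 - μ) * 1 :=
            add_le_add (mul_le_mul_of_nonneg_left (jind_le_one _ _ _) hμ0)
              (mul_le_mul_of_nonneg_left (jind_le_one _ _ _) (by linarith))
        _ = 1 := by ring
    have hne : u ≠ v := by rintro rfl; simp at hfar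
    have hnr : ¬ (gr ({s(x, y)} : Finset (Sym2 V))).Reachable u v := by
      intro h
      rcases hreach u v h with h' | ⟨rfl, rfl⟩ | ⟨rfl, rfl⟩
      · exact hne h'
      · rw [hedist_xy] at hfar
        have : L < 1 := by exact_mod_cast hfar
        omega
      · rw [SimpleGraph.edist_comm, hedist_xy] at hfar
        have : L < 1 := by exact_mod_cast hfar
        omega
    rw [jind_of_not_reachable (hempty _ _ hne), jind_of_not_reachable hnr]
    simp only [mul_zero, add_zero]
    exact pow_nonneg (by linarith) _

/-! ### One-point unions (cases 1 and 2 of the proof) -/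

section Union

variable {A B : Finset (Sym2 V)} {c : V}

omit [Fintype V] in
/-- Same-side distances in a one-point union, allowing the gluing vertex itself.
[cite: CharikarMakarychevMakarychev2010, Thm 3.3 proof, case 2 (p. 17)] -/
theorem edist_onePointUnion_same' (hAB : ∀ x, x ∈ supp A → x ∈ supp B → x = c) {u v : V}
    (hu : u ∉ supp B ∨ u = c) (hv : v ∉ supp B ∨ v = c) :
    (gr (A ∪ B)).edist u v = (gr A).edist u v := by
  refine le_antisymm (edist_anti_of_subset subset_union_left u v) ?_
  -- a `B`-leg between two vertices each isolated-in-`B`-or-equal-to-`c` collapses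
  have collapse : ∀ s t : V, (s ∉ supp B ∨ s = c) → (t ∉ supp B ∨ t = c) →
      (gr A).edist s t ≤ (gr B).edist s t := by
    intro s t hs ht
    by_cases hr : (gr B).Reachable s t
    · have hst : s = t := by
        rcases hs with hs | rfl
        · exact eq_of_reachable_of_notMem_supp hs hr
        · rcases ht with ht | rfl
          · exact (eq_of_reachable_of_notMem_supp ht hr.symm).symm
          · rfl
      subst hst; simp
    · rw [edist_eq_top_of_not_reachable hr]; exact le_top
  rcases edist_onePointUnion_cases hAB u v with h | h | ⟨X, Y, hX, hY, h⟩
  · exact h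
  · exact (collapse u v hu hv).trans h
  · refine le_trans ?_ h
    have legX : (gr A).edist u c ≤ (gr X).edist u c := by
      rcases hX with hX | hX <;> rw [hX]
      exact collapse u c hu (Or.inr rfl)
    have legY : (gr A).edist c v ≤ (gr Y).edist c v := by
      rcases hY with hY | hY <;> rw [hY]
      exact collapse c v (Or.inr rfl) hv
    exact (SimpleGraph.edist_triangle (v := c)).trans (add_le_add legX legY)

variable {μ : ℝ} {L : ℕ} {pA pB : Finset (Sym2 V) → ℝ}

omit [Fintype V] in
/-- Removing independent cuts from the two sides: `(A ∪ B) ∖ (S₁ ∪ S₂) = (A ∖ S₁) ∪ (B ∖ S₂)` for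
disjoint `A, B` and `S₂ ⊆ B`, `S₁ ⊆ A`. [cite: CharikarMakarychevMakarychev2010, Thm 3.3 proof, case 2 (p. 17)] -/
theorem union_sdiff_union (hdisj : Disjoint A B) {S₁ S₂ : Finset (Sym2 V)} (h₁ : S₁ ⊆ A) (h₂ : S₂ ⊆ B) :
    (A ∪ B) \ (S₁ ∪ S₂) = (A \ S₁) ∪ (B \ S₂) := by
  ext e
  simp only [mem_sdiff, mem_union, not_or]
  constructor
  · rintro ⟨h | h, hn₁, hn₂⟩
    · exact Or.inl ⟨h, hn₁⟩
    · exact Or.inr ⟨h, hn₂⟩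
  · rintro (⟨h, hn⟩ | ⟨h, hn⟩)
    · exact ⟨Or.inl h, hn, fun h' => Finset.disjoint_left.1 hdisj h (h₂ h')⟩
    · exact ⟨Or.inr h, fun h' => Finset.disjoint_left.1 hdisj (h₁ h') h, hn⟩

omit [Fintype V] in
/-- Supports of the cut sides still meet only in `c`. [cite: CharikarMakarychevMakarychev2010, Thm 3.3 proof, case 2 (p. 17)] -/
theorem meet_of_subsets (hAB : ∀ x, x ∈ supp A → x ∈ supp B → x = c) (S₁ S₂ : Finset (Sym2 V)) :
    ∀ x, x ∈ supp (A \ S₁) → x ∈ supp (B \ S₂) → x = c := fun x h1 h2 =>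
  hAB x (supp_mono sdiff_subset h1) (supp_mono sdiff_subset h2)

omit [DecidableEq V] in
/-- Nested sums weighted by `pA ⊗ pB` only see the supports. [folklore] -/
private theorem sum_sum_congr_support (f g : Finset (Sym2 V) → Finset (Sym2 V) → ℝ)
    (h : ∀ S₁ S₂, pA S₁ ≠ 0 → pB S₂ ≠ 0 → f S₁ S₂ = g S₁ S₂) :
    ∑ S₁, ∑ S₂, pA S₁ * pB S₂ * f S₁ S₂ = ∑ S₁, ∑ S₂, pA S₁ * pB S₂ * g S₁ S₂ := by
  refine Finset.sum_congr rfl fun S₁ _ => Finset.sum_congr rfl fun S₂ _ => ?_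
  by_cases h1 : pA S₁ = 0
  · simp [h1]
  by_cases h2 : pB S₂ = 0
  · simp [h2]
  rw [h S₁ S₂ h1 h2]

/-- **Same side: the probability of not being separated is that of the side**:
`Pr_{S₁∪S₂}[u ~ v] = Pr_{S₁}[u ~ v]` for `u, v` on the `A`-side (isolated in `B` or equal to `c`).
[cite: CharikarMakarychevMakarychev2010, Thm 3.3 proof, case 2 (p. 17: "S separates u and v if and only if S_i separates them")] -/
theorem jointProb_union_same (hdisj : Disjoint A B) (hAB : ∀ x, x ∈ supp A → x ∈ supp B → x = c)
    (hA : GoodMulticut μ L A pA) (hB : GoodMulticut μ L B pB) {u v : V}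
    (hu : u ∉ supp B ∨ u = c) (hv : v ∉ supp B ∨ v = c) :
    jointProb (prodU pA pB) (A ∪ B) u v = jointProb pA A u v := by
  unfold jointProb
  rw [sum_prodU_mul]
  have hu' : ∀ S₂, u ∉ supp (B \ S₂) ∨ u = c := fun S₂ =>
    hu.imp (fun h h' => h (supp_mono sdiff_subset h')) id
  have hv' : ∀ S₂, v ∉ supp (B \ S₂) ∨ v = c := fun S₂ =>
    hv.imp (fun h h' => h (supp_mono sdiff_subset h')) id
  rw [sum_sum_congr_support (pA := pA) (pB := pB) _ (fun S₁ _ => jind (A \ S₁) u v) fun S₁ S₂ h1 h2 => by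
    rw [union_sdiff_union hdisj (hA.subset S₁ h1) (hB.subset S₂ h2)]
    exact jind_congr (by
      rw [← edist_ne_top_iff_reachable, ← edist_ne_top_iff_reachable,
        edist_onePointUnion_same' (meet_of_subsets hAB S₁ S₂) (hu' S₂) (hv' S₂)])]
  refine Finset.sum_congr rfl fun S₁ _ => ?_
  have hterm : ∀ S₂, pA S₁ * pB S₂ * jind (A \ S₁) u v = pA S₁ * jind (A \ S₁) u v * pB S₂ :=
    fun _ => by ring
  rw [Finset.sum_congr rfl fun S₂ _ => hterm S₂, ← Finset.mul_sum, hB.total, mul_one]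

/-- **Across the gluing vertex the probabilities multiply**:
`Pr_{S₁∪S₂}[u ~ v] = Pr_{S₁}[u ~ c] · Pr_{S₂}[c ~ v]` for `u` isolated in `B`, `v` isolated in
`A`, `u ≠ v`. [cite: CharikarMakarychevMakarychev2010, Thm 3.3 proof, case 2 (p. 17: "= 1 − (1 − Pr(S_i separates u and c))(1 − Pr(S_j separates c and v))")] -/
theorem jointProb_union_cross (hdisj : Disjoint A B) (hAB : ∀ x, x ∈ supp A → x ∈ supp B → x = c)
    (hA : GoodMulticut μ L A pA) (hB : GoodMulticut μ L B pB) {u v : V}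
    (hu : u ∉ supp B) (hv : v ∉ supp A) (huv : u ≠ v) :
    jointProb (prodU pA pB) (A ∪ B) u v = jointProb pA A u c * jointProb pB B c v := by
  unfold jointProb
  rw [sum_prodU_mul]
  rw [sum_sum_congr_support (pA := pA) (pB := pB) _ (fun S₁ S₂ => jind (A \ S₁) u c * jind (B \ S₂) c v)
    fun S₁ S₂ h1 h2 => by
    rw [union_sdiff_union hdisj (hA.subset S₁ h1) (hB.subset S₂ h2)]
    have hu' : u ∉ supp (B \ S₂) := fun h' => hu (supp_mono sdiff_subset h')
    have hv' : v ∉ supp (A \ S₁) := fun h' => hv (supp_mono sdiff_subset h')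
    have hd := edist_onePointUnion_cross (meet_of_subsets hAB S₁ S₂) hu' hv' huv
    exact jind_eq_mul (by
      rw [← edist_ne_top_iff_reachable, ← edist_ne_top_iff_reachable, ← edist_ne_top_iff_reachable, hd,
        Ne, ENat.add_eq_top, not_or])]
  rw [Finset.sum_mul_sum]
  refine Finset.sum_congr rfl fun S₁ _ => Finset.sum_congr rfl fun S₂ _ => ?_
  ring

/-- Splitting `a + b = k` in `ℕ∞`. [folklore] -/
private theorem enat_add_eq_coe {a b : ℕ∞} {k : ℕ} (h : a + b = k) :
    ∃ k₁ k₂ : ℕ, a = k₁ ∧ b = k₂ ∧ k₁ + k₂ = k := by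
  have ha : a ≠ ⊤ := by rintro rfl; simp at h
  have hb : b ≠ ⊤ := by rintro rfl; simp at h
  obtain ⟨k₁, rfl⟩ := ENat.ne_top_iff_exists.1 ha
  obtain ⟨k₂, rfl⟩ := ENat.ne_top_iff_exists.1 hb
  refine ⟨k₁, k₂, rfl, rfl, ?_⟩
  exact_mod_cast h

/-- **The fields of Theorem 3.3 for a pair on the `A`-side of a one-point union.**
[cite: CharikarMakarychevMakarychev2010, Thm 3.3 proof, case 2 (p. 17)] -/
theorem union_core_same (hdisj : Disjoint A B) (hAB : ∀ x, x ∈ supp A → x ∈ supp B → x = c)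
    (hA : GoodMulticut μ L A pA) (hB : GoodMulticut μ L B pB) {u v : V}
    (hu : u ∉ supp B ∨ u = c) (hv : v ∉ supp B ∨ v = c) :
    (∀ k : ℕ, (gr (A ∪ B)).edist u v = k → k ≤ L → jointProb (prodU pA pB) (A ∪ B) u v = (1 - μ) ^ k) ∧
    ((L : ℕ∞) < (gr (A ∪ B)).edist u v → jointProb (prodU pA pB) (A ∪ B) u v ≤ (1 - μ) ^ L) ∧
    (∀ S₁ S₂, pA S₁ ≠ 0 → pB S₂ ≠ 0 → (gr (A ∪ B)).edist u v ≤ L →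
      (gr ((A \ S₁) ∪ (B \ S₂))).Reachable u v →
      (gr ((A \ S₁) ∪ (B \ S₂))).edist u v = (gr (A ∪ B)).edist u v) := by
  rw [jointProb_union_same hdisj hAB hA hB hu hv, edist_onePointUnion_same' hAB hu hv]
  refine ⟨fun k hk hkL => hA.exact u v k hk hkL, fun hfar => hA.far u v hfar, ?_⟩
  intro S₁ S₂ h1 _ hd hr
  have hu' : u ∉ supp (B \ S₂) ∨ u = c := hu.imp (fun h h' => h (supp_mono sdiff_subset h')) id
  have hv' : v ∉ supp (B \ S₂) ∨ v = c := hv.imp (fun h h' => h (supp_mono sdiff_subset h')) id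
  rw [edist_onePointUnion_same' (meet_of_subsets hAB S₁ S₂) hu' hv'] at ⊢
  rw [← edist_ne_top_iff_reachable, edist_onePointUnion_same' (meet_of_subsets hAB S₁ S₂) hu' hv',
    edist_ne_top_iff_reachable] at hr
  exact hA.geodesic S₁ u v h1 hd hr

/-- **The fields of Theorem 3.3 for a pair across the gluing vertex.**
[cite: CharikarMakarychevMakarychev2010, Thm 3.3 proof, case 2 (p. 17)] -/
theorem union_core_cross (hμ0 : 0 ≤ μ) (hμ1 : μ ≤ 1) (hdisj : Disjoint A B)
    (hAB : ∀ x, x ∈ supp A → x ∈ supp B → x = c)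
    (hA : GoodMulticut μ L A pA) (hB : GoodMulticut μ L B pB) {u v : V}
    (hu : u ∉ supp B) (hv : v ∉ supp A) (huv : u ≠ v) :
    (∀ k : ℕ, (gr (A ∪ B)).edist u v = k → k ≤ L → jointProb (prodU pA pB) (A ∪ B) u v = (1 - μ) ^ k) ∧
    ((L : ℕ∞) < (gr (A ∪ B)).edist u v → jointProb (prodU pA pB) (A ∪ B) u v ≤ (1 - μ) ^ L) ∧
    (∀ S₁ S₂, pA S₁ ≠ 0 → pB S₂ ≠ 0 → (gr (A ∪ B)).edist u v ≤ L →
      (gr ((A \ S₁) ∪ (B \ S₂))).Reachable u v →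
      (gr ((A \ S₁) ∪ (B \ S₂))).edist u v = (gr (A ∪ B)).edist u v) := by
  rw [jointProb_union_cross hdisj hAB hA hB hu hv huv, edist_onePointUnion_cross hAB hu hv huv]
  have h1μ : 0 ≤ 1 - μ := by linarith
  have h1μ' : 1 - μ ≤ 1 := by linarith
  refine ⟨fun k hk hkL => ?_, fun hfar => ?_, fun S₁ S₂ h1 h2 hd hr => ?_⟩
  · obtain ⟨k₁, k₂, hk₁, hk₂, rfl⟩ := enat_add_eq_coe hk
    rw [hA.exact u c k₁ hk₁ (by omega), hB.exact c v k₂ hk₂ (by omega), pow_add]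
  · -- far pairs: one leg is far, or both legs are near but long together
    by_cases hfa : (L : ℕ∞) < (gr A).edist u c
    · calc jointProb pA A u c * jointProb pB B c v ≤ (1 - μ) ^ L * 1 :=
            mul_le_mul (hA.far u c hfa) (hB.jointProb_le_one c v) (hB.jointProb_nonneg c v)
              (pow_nonneg h1μ _)
        _ = (1 - μ) ^ L := mul_one _
    by_cases hfb : (L : ℕ∞) < (gr B).edist c v
    · calc jointProb pA A u c * jointProb pB B c v ≤ 1 * (1 - μ) ^ L :=
            mul_le_mul (hA.jointProb_le_one u c) (hB.far c v hfb) (hB.jointProb_nonneg c v) zero_le_one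
        _ = (1 - μ) ^ L := one_mul _
    rw [not_lt] at hfa hfb
    obtain ⟨k₁, hk₁⟩ := ENat.ne_top_iff_exists.1 (ne_top_of_le_ne_top (ENat.coe_ne_top L) hfa)
    obtain ⟨k₂, hk₂⟩ := ENat.ne_top_iff_exists.1 (ne_top_of_le_ne_top (ENat.coe_ne_top L) hfb)
    rw [← hk₁] at hfa hfar; rw [← hk₂] at hfb hfar
    have hk₁L : k₁ ≤ L := by exact_mod_cast hfa
    have hk₂L : k₂ ≤ L := by exact_mod_cast hfb
    have hsum : L < k₁ + k₂ := by exact_mod_cast hfar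
    rw [hA.exact u c k₁ hk₁.symm hk₁L, hB.exact c v k₂ hk₂.symm hk₂L, ← pow_add]
    exact pow_le_pow_of_le_one h1μ h1μ' hsum.le
  · have hu' : u ∉ supp (B \ S₂) := fun h' => hu (supp_mono sdiff_subset h')
    have hv' : v ∉ supp (A \ S₁) := fun h' => hv (supp_mono sdiff_subset h')
    have hd' := edist_onePointUnion_cross (meet_of_subsets hAB S₁ S₂) hu' hv' huv
    rw [hd']
    rw [← edist_ne_top_iff_reachable, hd', Ne, ENat.add_eq_top, not_or, ← Ne, ← Ne,
      edist_ne_top_iff_reachable, edist_ne_top_iff_reachable] at hr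
    have hdA : (gr A).edist u c ≤ L := le_trans (by simp) hd
    have hdB : (gr B).edist c v ≤ L := le_trans (by simp) hd
    rw [hA.geodesic S₁ u c h1 hdA hr.1, hB.geodesic S₂ c v h2 hdB hr.2]

/-- **Cases 1–2 of Theorem 3.3: the independent union of good multicut distributions of two edge
sets glued at (at most) one vertex is a good multicut distribution of the union.**
[cite: CharikarMakarychevMakarychev2010, Thm 3.3 proof, cases 1–2 (p. 17–18)] -/
theorem GoodMulticut.union (hμ0 : 0 ≤ μ) (hμ1 : μ ≤ 1) (hdisj : Disjoint A B)
    (hAB : ∀ x, x ∈ supp A → x ∈ supp B → x = c)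
    (hA : GoodMulticut μ L A pA) (hB : GoodMulticut μ L B pB) :
    GoodMulticut μ L (A ∪ B) (prodU pA pB) := by
  have hBA : ∀ x, x ∈ supp B → x ∈ supp A → x = c := fun x h1 h2 => hAB x h2 h1
  -- the per-pair statements, by the side configuration of `(u, v)`
  have core : ∀ u v : V,
      (∀ k : ℕ, (gr (A ∪ B)).edist u v = k → k ≤ L → jointProb (prodU pA pB) (A ∪ B) u v = (1 - μ) ^ k) ∧
      ((L : ℕ∞) < (gr (A ∪ B)).edist u v → jointProb (prodU pA pB) (A ∪ B) u v ≤ (1 - μ) ^ L) ∧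
      (∀ S₁ S₂, pA S₁ ≠ 0 → pB S₂ ≠ 0 → (gr (A ∪ B)).edist u v ≤ L →
        (gr ((A \ S₁) ∪ (B \ S₂))).Reachable u v →
        (gr ((A \ S₁) ∪ (B \ S₂))).edist u v = (gr (A ∪ B)).edist u v) := by
    intro u v
    by_cases hs1 : (u ∉ supp B ∨ u = c) ∧ (v ∉ supp B ∨ v = c)
    · exact union_core_same hdisj hAB hA hB hs1.1 hs1.2
    by_cases hs2 : (u ∉ supp A ∨ u = c) ∧ (v ∉ supp A ∨ v = c)
    · -- the `B`-side: swap the roles of `A` and `B`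
      have h := union_core_same hdisj.symm hBA hB hA hs2.1 hs2.2
      rw [prodU_comm pB pA, union_comm B A] at h
      refine ⟨h.1, h.2.1, fun S₁ S₂ h1 h2 => ?_⟩
      have := h.2.2 S₂ S₁ h2 h1
      rwa [union_comm (B \ S₂)] at this
    -- a genuinely crossing pair
    have key : ∀ w : V, w ∈ supp A → w ∈ supp B → w = c := hAB
    by_cases huB : u ∈ supp B ∧ u ≠ c
    · -- `u` strictly on the `B`-side, so `v` strictly on the `A`-side
      have huA : u ∉ supp A := fun h => huB.2 (key u h huB.1)
      have hvA : v ∈ supp A ∧ v ≠ c := by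
        by_contra hcon
        exact hs2 ⟨Or.inl huA, by tauto⟩
      have hvB : v ∉ supp B := fun h => hvA.2 (key v hvA.1 h)
      have hvu : v ≠ u := fun h => huA (h ▸ hvA.1)
      have h := union_core_cross hμ0 hμ1 hdisj hAB hA hB hvB huA hvu
      rw [jointProb_comm, SimpleGraph.edist_comm] at h
      refine ⟨h.1, h.2.1, fun S₁ S₂ h1 h2 hd hr => ?_⟩
      have := h.2.2 S₁ S₂ h1 h2 hd (by rwa [SimpleGraph.reachable_comm] at hr)
      rwa [SimpleGraph.edist_comm (u := v)] at this
    · have hu1 : u ∉ supp B ∨ u = c := by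
        by_cases hc : u = c
        · exact Or.inr hc
        · exact Or.inl fun h => huB ⟨h, hc⟩
      have hvB : v ∈ supp B ∧ v ≠ c := by
        by_contra hcon
        exact hs1 ⟨hu1, by tauto⟩
      have hvA : v ∉ supp A := fun h => hvB.2 (key v h hvB.1)
      have huA : u ∈ supp A ∧ u ≠ c := by
        by_contra hcon
        exact hs2 ⟨by tauto, Or.inl hvA⟩
      have huB' : u ∉ supp B := fun h => huA.2 (key u huA.1 h)
      have huv : u ≠ v := fun h => hvA (h ▸ huA.1)
      exact union_core_cross hμ0 hμ1 hdisj hAB hA hB huB' hvA huv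
  refine ⟨prodU_nonneg hA.nonneg hB.nonneg, sum_prodU pA pB hA.total hB.total, fun S hS => ?_,
    fun S hS => ?_, fun u v k hk hkL => (core u v).1 k hk hkL, fun S u v hS hd hr => ?_,
    fun u v hfar => (core u v).2.1 hfar⟩
  · obtain ⟨S₁, S₂, rfl, h1, h2⟩ := exists_of_prodU_ne_zero hS
    exact union_subset_union (hA.subset S₁ h1) (hB.subset S₂ h2)
  · obtain ⟨S₁, S₂, rfl, h1, h2⟩ := exists_of_prodU_ne_zero hS
    rw [union_sdiff_union hdisj (hA.subset S₁ h1) (hB.subset S₂ h2)]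
    exact isAcyclic_onePointUnion (meet_of_subsets hAB S₁ S₂) (hA.acyclic S₁ h1) (hB.acyclic S₂ h2)
  · obtain ⟨S₁, S₂, rfl, h1, h2⟩ := exists_of_prodU_ne_zero hS
    rw [union_sdiff_union hdisj (hA.subset S₁ h1) (hB.subset S₂ h2)] at hr ⊢
    exact (core u v).2.2 S₁ S₂ h1 h2 hd hr

end Union

/-! ### Lemma 3.4: paths -/

section Bernoulli

variable {α : Type*} [DecidableEq α]

/-- The Bernoulli(`µ`) product weight of the cut set `T` inside the block `P`:
`µ^{|T|} (1−µ)^{|P|−|T|}`. [cite: CharikarMakarychevMakarychev2010, Lemma 3.4 proof (p. 16: "We now add every edge to S with probability µ")] -/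
def bern (μ : ℝ) (P T : Finset α) : ℝ := μ ^ T.card * (1 - μ) ^ (P.card - T.card)

omit [DecidableEq α] in
/-- `bern ≥ 0` for `0 ≤ µ ≤ 1`. [cite: CharikarMakarychevMakarychev2010, Lemma 3.4 proof (p. 16)] -/
theorem bern_nonneg {μ : ℝ} (h0 : 0 ≤ μ) (h1 : μ ≤ 1) (P T : Finset α) : 0 ≤ bern μ P T :=
  mul_nonneg (pow_nonneg h0 _) (pow_nonneg (by linarith) _)

omit [DecidableEq α] in
/-- The empty cut has weight `(1−µ)^{|P|}`. [cite: CharikarMakarychevMakarychev2010, Lemma 3.4 proof (p. 16)] -/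
theorem bern_empty (μ : ℝ) (P : Finset α) : bern μ P ∅ = (1 - μ) ^ P.card := by simp [bern]

/-- **Independent coins avoid a fixed set `W ⊆ P` with probability `(1−µ)^{|W|}`.**
[cite: CharikarMakarychevMakarychev2010, Lemma 3.4 proof (p. 17: "the probability that S separates u and v is 1 − (1 − µ)^{d(u,v)}")] -/
theorem sum_bern_disjoint (μ : ℝ) {P W : Finset α} (hW : W ⊆ P) :
    ∑ T ∈ P.powerset, bern μ P T * (if Disjoint W T then 1 else 0) = (1 - μ) ^ W.card := by
  rw [← Finset.sum_filter_of_ne (p := fun T => Disjoint W T) (fun T _ h => by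
    by_contra hd; simp [hd] at h)]
  have hset : P.powerset.filter (fun T => Disjoint W T) = (P \ W).powerset := by
    ext T
    simp only [mem_filter, mem_powerset, subset_sdiff]
    constructor
    · rintro ⟨h1, h2⟩; exact ⟨h1, h2.symm⟩
    · rintro ⟨h1, h2⟩; exact ⟨h1, h2.symm⟩
  rw [hset]
  have hcard : P.card = W.card + (P \ W).card := by
    have := card_le_card hW
    rw [card_sdiff_of_subset hW]; omega
  calc ∑ T ∈ (P \ W).powerset, bern μ P T * (if Disjoint W T then 1 else 0)
      = ∑ T ∈ (P \ W).powerset, (1 - μ) ^ W.card * (μ ^ T.card * (1 - μ) ^ ((P \ W).card - T.card)) := by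
        refine Finset.sum_congr rfl fun T hT => ?_
        have hT' := mem_powerset.1 hT
        have hdisj : Disjoint W T := (subset_sdiff.1 hT').2.symm
        rw [if_pos hdisj, mul_one, bern, hcard]
        have hle : T.card ≤ (P \ W).card := card_le_card hT'
        rw [show W.card + (P \ W).card - T.card = W.card + ((P \ W).card - T.card) by omega, pow_add]
        ring
    _ = (1 - μ) ^ W.card := by
        rw [← Finset.mul_sum, Finset.sum_pow_mul_eq_add_pow, show μ + (1 - μ) = 1 by ring, one_pow,
          mul_one]

/-- Total mass of the Bernoulli block: `Σ_T bern = 1`. [cite: CharikarMakarychevMakarychev2010, Lemma 3.4 proof (p. 16)] -/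
theorem sum_bern (μ : ℝ) (P : Finset α) : ∑ T ∈ P.powerset, bern μ P T = 1 := by
  have := sum_bern_disjoint μ (empty_subset P)
  simpa using this

/-- The mass of the nonempty cuts: `1 − (1−µ)^{|P|}`. [cite: CharikarMakarychevMakarychev2010, Lemma 3.4 proof (p. 16: "at least 1 − (1 − µ)^L")] -/
theorem sum_bern_erase_empty (μ : ℝ) (P : Finset α) :
    ∑ T ∈ P.powerset.erase ∅, bern μ P T = 1 - (1 - μ) ^ P.card := by
  have h := Finset.add_sum_erase P.powerset (bern μ P) (empty_mem_powerset P)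
  rw [sum_bern, bern_empty] at h
  linarith

/-- `sum_bern_disjoint` for an arbitrary avoided set `W` (only `W ∩ P` matters).
[cite: CharikarMakarychevMakarychev2010, Lemma 3.4 proof (p. 17)] -/
theorem sum_bern_disjoint' (μ : ℝ) (P W : Finset α) :
    ∑ T ∈ P.powerset, bern μ P T * (if Disjoint W T then 1 else 0) = (1 - μ) ^ (W ∩ P).card := by
  rw [← sum_bern_disjoint μ (inter_subset_right (s₁ := W) (s₂ := P))]
  refine Finset.sum_congr rfl fun T hT => ?_
  have hT' := mem_powerset.1 hT
  congr 1
  have : Disjoint W T ↔ Disjoint (W ∩ P) T := by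
    constructor
    · exact fun h => h.mono_left inter_subset_left
    · intro h
      rw [Finset.disjoint_left] at h ⊢
      exact fun e heW heT => h (mem_inter.2 ⟨heW, hT' heT⟩) heT
  simp only [this]

end Bernoulli

section Path

variable {a : ℕ → V} {m L : ℕ} {μ : ℝ}

/-- The `k`-th edge of the path. [cite: CharikarMakarychevMakarychev2010, Lemma 3.4 (p. 16)] -/
def ek (a : ℕ → V) (k : ℕ) : Sym2 V := s(a k, a (k + 1))

/-- The edges with indices in `[lo, hi)`. [cite: CharikarMakarychevMakarychev2010, Lemma 3.4 proof (p. 16: "subdivide the path into three paths")] -/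
def seg (a : ℕ → V) (lo hi : ℕ) : Finset (Sym2 V) := (Ico lo hi).image (ek a)

omit [Fintype V] in
/-- `pathEdges` is the full segment. [cite: CharikarMakarychevMakarychev2010, Lemma 3.4 (p. 16)] -/
theorem pathEdges_eq_seg (a : ℕ → V) (m : ℕ) : pathEdges a m = seg a 0 m := by
  ext e; simp [pathEdges, seg, ek, mem_image]

omit [Fintype V] [DecidableEq V] in
/-- The edge map is injective on `[0, m]` when `a` is injective there. [cite: CharikarMakarychevMakarychev2010, Lemma 3.4 (p. 16)] -/
theorem ek_inj (ha : ∀ i j, i ≤ m → j ≤ m → a i = a j → i = j) {i j : ℕ} (hi : i < m) (hj : j < m)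
    (h : ek a i = ek a j) : i = j := by
  rcases Sym2.eq_iff.1 h with ⟨h1, -⟩ | ⟨h1, h2⟩
  · exact ha i j hi.le hj.le h1
  · have := ha i (j + 1) hi.le (by omega) h1
    have := ha (i + 1) j (by omega) hj.le h2
    omega

omit [Fintype V] in
/-- Membership in a segment. [cite: CharikarMakarychevMakarychev2010, Lemma 3.4 proof (p. 16)] -/
theorem mem_seg {lo hi : ℕ} {e : Sym2 V} : e ∈ seg a lo hi ↔ ∃ k, lo ≤ k ∧ k < hi ∧ ek a k = e := by
  simp [seg, mem_image, and_assoc]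

omit [Fintype V] in
/-- Cardinality of a segment inside `[0, m)`. [cite: CharikarMakarychevMakarychev2010, Lemma 3.4 proof (p. 16)] -/
theorem card_seg (ha : ∀ i j, i ≤ m → j ≤ m → a i = a j → i = j) {lo hi : ℕ} (h : hi ≤ m) :
    (seg a lo hi).card = hi - lo := by
  rw [seg, card_image_of_injOn, Nat.card_Ico]
  intro i hi j hj hij
  simp only [coe_Ico, Set.mem_Ico] at hi hj
  exact ek_inj ha (by omega) (by omega) hij

omit [Fintype V] in
/-- Segments are monotone in the interval. [cite: CharikarMakarychevMakarychev2010, Lemma 3.4 proof (p. 16)] -/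
theorem seg_subset_seg {lo hi lo' hi' : ℕ} (h1 : lo' ≤ lo) (h2 : hi ≤ hi') : seg a lo hi ⊆ seg a lo' hi' := by
  intro e he
  obtain ⟨k, hk1, hk2, rfl⟩ := mem_seg.1 he
  exact mem_seg.2 ⟨k, by omega, by omega, rfl⟩

omit [Fintype V] in
/-- Disjoint index intervals inside `[0,m)` give disjoint segments. [cite: CharikarMakarychevMakarychev2010, Lemma 3.4 proof (p. 16)] -/
theorem disjoint_seg (ha : ∀ i j, i ≤ m → j ≤ m → a i = a j → i = j) {lo hi lo' hi' : ℕ}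
    (h : hi ≤ lo') (hm2 : hi' ≤ m) : Disjoint (seg a lo hi) (seg a lo' hi') := by
  rw [Finset.disjoint_left]
  intro e he he'
  obtain ⟨k, hk1, hk2, rfl⟩ := mem_seg.1 he
  obtain ⟨k', hk1', hk2', hkk⟩ := mem_seg.1 he'
  have := ek_inj ha (by omega) (by omega) hkk
  omega

omit [Fintype V] in
/-- A cut set misses the segment `[lo,hi)` iff it contains none of its edges.
[cite: CharikarMakarychevMakarychev2010, Lemma 3.4 proof (p. 16)] -/
theorem disjoint_seg_iff {lo hi : ℕ} {S : Finset (Sym2 V)} :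
    Disjoint (seg a lo hi) S ↔ ∀ k, lo ≤ k → k < hi → ek a k ∉ S := by
  rw [Finset.disjoint_left]
  constructor
  · intro h k hk1 hk2 hkS
    exact h (mem_seg.2 ⟨k, hk1, hk2, rfl⟩) hkS
  · intro h e he heS
    obtain ⟨k, hk1, hk2, rfl⟩ := mem_seg.1 he
    exact h k hk1 hk2 heS

/-! #### Walks in a path with some edges removed -/

omit [Fintype V] in
/-- **Walks inside a sub-path**: in `gr B` with `B ⊆` path edges, a walk from `a_i` to `a_j` has
length `≥ |i − j|` and all path edges between `i` and `j` lie in `B`.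
[cite: CharikarMakarychevMakarychev2010, Lemma 3.4 proof (p. 17: "If S contains an edge from P₂ then u and v are separated")] -/
theorem walk_in_path (ha : ∀ i j, i ≤ m → j ≤ m → a i = a j → i = j) {B : Finset (Sym2 V)}
    (hB : B ⊆ pathEdges a m) {x y : V} (w : (gr B).Walk x y) :
    ∀ i j : ℕ, i ≤ m → j ≤ m → x = a i → y = a j →
      max i j - min i j ≤ w.length ∧ ∀ k, min i j ≤ k → k < max i j → ek a k ∈ B := by
  induction w with
  | nil =>
    intro i j hi hj hx hy
    have := ha i j hi hj (hx.symm.trans hy)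
    subst this
    exact ⟨by simp, fun k hk1 hk2 => by omega⟩
  | @cons x z y hadj w' ih =>
    intro i j hi hj hx hy
    have hmem := (gr_adj.1 hadj).1
    obtain ⟨k, hkm, hke⟩ := mem_pathEdges.1 (hB hmem)
    -- `x = a i` is an endpoint of the edge `{a k, a (k+1)}`, `z` is the other one
    have hkB : ek a k ∈ B := by
      unfold ek; rw [hke]; exact hmem
    have hxmem : x ∈ (s(a k, a (k + 1)) : Sym2 V) := by rw [hke]; simp
    have hzmem : z ∈ (s(a k, a (k + 1)) : Sym2 V) := by rw [hke]; simp
    have hxz : x ≠ z := hadj.ne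
    rw [Sym2.mem_iff] at hxmem hzmem
    have hz : ∃ i', i' ≤ m ∧ z = a i' ∧ (i' = i + 1 ∨ i' + 1 = i) ∧ ek a (min i i') ∈ B := by
      rcases hxmem with h1 | h1
      · have hik : k = i := ha k i hkm.le hi (h1.symm.trans hx)
        subst hik
        have h2 : z = a (k + 1) := by
          rcases hzmem with h2 | h2
          · exact absurd (h1.trans h2.symm) hxz
          · exact h2
        refine ⟨k + 1, by omega, h2, Or.inl rfl, ?_⟩
        rw [show min k (k + 1) = k by omega]; exact hkB
      · have hik : k + 1 = i := ha (k + 1) i (by omega) hi (h1.symm.trans hx)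
        subst hik
        have h2 : z = a k := by
          rcases hzmem with h2 | h2
          · exact h2
          · exact absurd (h1.trans h2.symm) hxz
        refine ⟨k, hkm.le, h2, Or.inr rfl, ?_⟩
        rw [show min (k + 1) k = k by omega]; exact hkB
    obtain ⟨i', hi'm, hz', hii', hedge⟩ := hz
    obtain ⟨hlen, hall⟩ := ih i' j hi'm hj hz' hy
    simp only [Walk.length_cons]
    refine ⟨by rcases hii' with h | h <;> omega, fun k' hk1 hk2 => ?_⟩
    by_cases hk' : k' = min i i'
    · rw [hk']; exact hedge
    · exact hall k' (by rcases hii' with h | h <;> omega) (by rcases hii' with h | h <;> omega)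

omit [Fintype V] [DecidableEq V] in
/-- **Walking along an intact segment**: if all edges with indices in `[i, i+d)` lie in `B` then
`a_i` and `a_{i+d}` are joined in `gr B` by a walk of length `d`.
[cite: CharikarMakarychevMakarychev2010, Lemma 3.4 proof (p. 16–17)] -/
theorem exists_walk_seg (ha : ∀ i j, i ≤ m → j ≤ m → a i = a j → i = j) {B : Finset (Sym2 V)}
    {i : ℕ} : ∀ d : ℕ, i + d ≤ m → (∀ k, i ≤ k → k < i + d → ek a k ∈ B) →
      ∃ w : (gr B).Walk (a i) (a (i + d)), w.length = d := by
  intro d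
  induction d generalizing i with
  | zero => intro _ _; exact ⟨Walk.nil, rfl⟩
  | succ d ih =>
    intro hd hall
    have hadj : (gr B).Adj (a i) (a (i + 1)) :=
      gr_adj.2 ⟨hall i le_rfl (by omega), fun h => by
        have := ha i (i + 1) (by omega) (by omega) h; omega⟩
    obtain ⟨w, hw⟩ := ih (i := i + 1) (by omega) fun k hk1 hk2 => hall k (by omega) (by omega)
    refine ⟨Walk.cons hadj (w.copy rfl (by rw [Nat.add_assoc, Nat.add_comm 1 d])), ?_⟩
    simp [hw]

omit [Fintype V] in
/-- **Distances along a sub-path**: for `B ⊆` path edges and `i ≤ j ≤ m`, in `gr B` the vertices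
`a_i, a_j` are joined iff no edge between them is missing, and then their distance is `j − i`.
[cite: CharikarMakarychevMakarychev2010, Lemma 3.4 proof (p. 16–17)] -/
theorem edist_in_path (ha : ∀ i j, i ≤ m → j ≤ m → a i = a j → i = j) {B : Finset (Sym2 V)}
    (hB : B ⊆ pathEdges a m) {i j : ℕ} (hij : i ≤ j) (hj : j ≤ m) :
    ((∀ k, i ≤ k → k < j → ek a k ∈ B) → (gr B).edist (a i) (a j) = (j - i : ℕ)) ∧
    ((∃ k, i ≤ k ∧ k < j ∧ ek a k ∉ B) → ¬ (gr B).Reachable (a i) (a j)) := by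
  constructor
  · intro hall
    obtain ⟨w, hw⟩ := exists_walk_seg ha (j - i) (by omega) (fun k hk1 hk2 => hall k hk1 (by omega))
    have hji : i + (j - i) = j := by omega
    refine le_antisymm ?_ ?_
    · have := edist_le (w.copy rfl (by rw [hji]))
      simpa [hw] using this
    · obtain ⟨w₀, hw₀⟩ := (w.copy rfl (by rw [hji])).reachable.exists_walk_length_eq_edist
      rw [← hw₀]
      have := (walk_in_path ha hB w₀ i j (by omega) hj rfl rfl).1
      rw [show max i j = j by omega, show min i j = i by omega] at this
      exact_mod_cast this
  · rintro ⟨k, hk1, hk2, hkB⟩ ⟨w⟩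
    have := (walk_in_path ha hB w i j (by omega) hj rfl rfl).2 k (by omega) (by omega)
    exact hkB this

/-! #### The coupled coin distribution on a path of length `m ≥ 3L` -/

/-- The coupling factor between the first and last blocks: no mass on "both uncut", reweighted
elsewhere so that both marginals stay Bernoulli (`q = (1−µ)^L`).
[cite: CharikarMakarychevMakarychev2010, Lemma 3.4 proof (p. 16: "we add to S at least one edge either from P₁ or from P₃. This coupling is possible since …")] -/
def coupling (q : ℝ) (T₁ T₃ : Finset (Sym2 V)) : ℝ :=
  if T₁ = ∅ ∧ T₃ = ∅ then 0 else if T₁ = ∅ ∨ T₃ = ∅ then 1 / (1 - q) else (1 - 2 * q) / (1 - q) ^ 2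

omit [Fintype V] in
/-- The coupling factor is nonnegative for `q ≤ 1/2`. [cite: CharikarMakarychevMakarychev2010, Lemma 3.4 proof (p. 16)] -/
theorem coupling_nonneg {q : ℝ} (hq : q ≤ 1 / 2) (T₁ T₃ : Finset (Sym2 V)) : 0 ≤ coupling q T₁ T₃ := by
  unfold coupling
  split_ifs
  · exact le_rfl
  · exact div_nonneg zero_le_one (by linarith)
  · exact div_nonneg (by linarith) (sq_nonneg _)

omit [Fintype V] in
/-- The coupling factor is symmetric. [cite: CharikarMakarychevMakarychev2010, Lemma 3.4 proof (p. 16)] -/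
theorem coupling_comm (q : ℝ) (T₁ T₃ : Finset (Sym2 V)) : coupling q T₁ T₃ = coupling q T₃ T₁ := by
  unfold coupling
  simp only [and_comm, or_comm]

omit [Fintype V] in
/-- **The marginals of the coupling are Bernoulli**: for every `T₁`,
`Σ_{T₃ ⊆ P₃} bern(T₃) · coupling(T₁,T₃) = 1` when `bern(∅) = q ≤ 1/2`.
[cite: CharikarMakarychevMakarychev2010, Lemma 3.4 proof (p. 16: "all decisions for P₂ and P₃ are independent")] -/
theorem sum_bern_coupling {q : ℝ} (hq : q ≤ 1 / 2) {P₃ : Finset (Sym2 V)} (hP : (1 - μ) ^ P₃.card = q)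
    (T₁ : Finset (Sym2 V)) : ∑ T₃ ∈ P₃.powerset, bern μ P₃ T₃ * coupling q T₁ T₃ = 1 := by
  have hq1 : 1 - q ≠ 0 := by linarith
  rw [← Finset.add_sum_erase P₃.powerset _ (empty_mem_powerset P₃), bern_empty, hP]
  have hrest : ∀ T₃ ∈ P₃.powerset.erase ∅, bern μ P₃ T₃ * coupling q T₁ T₃ =
      bern μ P₃ T₃ * (if T₁ = ∅ then 1 / (1 - q) else (1 - 2 * q) / (1 - q) ^ 2) := by
    intro T₃ hT₃
    have hne : T₃ ≠ ∅ := (mem_erase.1 hT₃).1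
    unfold coupling
    by_cases h1 : T₁ = ∅ <;> simp [h1, hne]
  rw [Finset.sum_congr rfl hrest, ← Finset.sum_mul, sum_bern_erase_empty, hP]
  have hc : coupling q T₁ ∅ = if T₁ = ∅ then 0 else 1 / (1 - q) := by
    unfold coupling; by_cases h1 : T₁ = ∅ <;> simp [h1]
  rw [hc]
  by_cases h1 : T₁ = ∅
  · rw [if_pos h1, if_pos h1, mul_zero, zero_add, mul_one_div_cancel hq1]
  · rw [if_neg h1, if_neg h1]
    field_simp
    ring

variable (a m L μ) in
/-- The joint distribution of the cuts in the first and last blocks `P₁ = seg[0,L)`,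
`P₃ = seg[m−L,m)`: Bernoulli marginals coupled by `coupling`. [cite: CharikarMakarychevMakarychev2010, Lemma 3.4 proof (p. 16)] -/
def q13 : Finset (Sym2 V) → ℝ := fun S =>
  ∑ T₁ ∈ (seg a 0 L).powerset, ∑ T₃ ∈ (seg a (m - L) m).powerset,
    if T₁ ∪ T₃ = S then bern μ (seg a 0 L) T₁ * bern μ (seg a (m - L) m) T₃ *
      coupling ((1 - μ) ^ L) T₁ T₃ else 0

variable (a m L μ) in
/-- The independent Bernoulli cuts of the middle block `P₂ = seg[L, m−L)`.
[cite: CharikarMakarychevMakarychev2010, Lemma 3.4 proof (p. 16)] -/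
def q2 : Finset (Sym2 V) → ℝ := fun S =>
  if S ⊆ seg a L (m - L) then bern μ (seg a L (m - L)) S else 0

variable (a m L μ) in
/-- **The multicut distribution of Lemma 3.4** on the path `a_0 … a_m`.
[cite: CharikarMakarychevMakarychev2010, Lemma 3.4 (p. 16)] -/
def pathDist : Finset (Sym2 V) → ℝ := prodU (q13 a m L μ) (q2 a m L μ)

/-- Expectations under `q13`. [cite: CharikarMakarychevMakarychev2010, Lemma 3.4 proof (p. 16)] -/
theorem sum_q13_mul (f : Finset (Sym2 V) → ℝ) :
    ∑ S, q13 a m L μ S * f S = ∑ T₁ ∈ (seg a 0 L).powerset, ∑ T₃ ∈ (seg a (m - L) m).powerset,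
      bern μ (seg a 0 L) T₁ * bern μ (seg a (m - L) m) T₃ * coupling ((1 - μ) ^ L) T₁ T₃ * f (T₁ ∪ T₃) := by
  unfold q13
  simp_rw [Finset.sum_mul]
  rw [Finset.sum_comm]
  refine Finset.sum_congr rfl fun T₁ _ => ?_
  rw [Finset.sum_comm]
  refine Finset.sum_congr rfl fun T₃ _ => ?_
  simp_rw [ite_mul, zero_mul]
  rw [Finset.sum_ite_eq]
  simp

/-- Expectations under `q2`. [cite: CharikarMakarychevMakarychev2010, Lemma 3.4 proof (p. 16)] -/
theorem sum_q2_mul (f : Finset (Sym2 V) → ℝ) :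
    ∑ S, q2 a m L μ S * f S = ∑ T ∈ (seg a L (m - L)).powerset, bern μ (seg a L (m - L)) T * f T := by
  unfold q2
  simp_rw [ite_mul, zero_mul]
  rw [← Finset.sum_filter]
  refine Finset.sum_congr ?_ fun _ _ => rfl
  ext T; simp

/-- **Expectations under the path distribution.** [cite: CharikarMakarychevMakarychev2010, Lemma 3.4 proof (p. 16)] -/
theorem sum_pathDist_mul (f : Finset (Sym2 V) → ℝ) :
    ∑ S, pathDist a m L μ S * f S =
      ∑ T₁ ∈ (seg a 0 L).powerset, ∑ T₃ ∈ (seg a (m - L) m).powerset,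
        bern μ (seg a 0 L) T₁ * bern μ (seg a (m - L) m) T₃ * coupling ((1 - μ) ^ L) T₁ T₃ *
        ∑ T₂ ∈ (seg a L (m - L)).powerset, bern μ (seg a L (m - L)) T₂ * f (T₁ ∪ T₃ ∪ T₂) := by
  unfold pathDist
  rw [sum_prodU_mul]
  have : ∀ S₁, ∑ S₂, q13 a m L μ S₁ * q2 a m L μ S₂ * f (S₁ ∪ S₂) =
      q13 a m L μ S₁ * ∑ S₂, q2 a m L μ S₂ * f (S₁ ∪ S₂) := fun S₁ => by
    rw [Finset.mul_sum]; refine Finset.sum_congr rfl fun S₂ _ => ?_; ring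
  simp_rw [this, sum_q2_mul]
  rw [sum_q13_mul]


/-! #### Lemma 3.4 -/

section Lemma34

omit [Fintype V] [DecidableEq V] in
/-- `L ≥ 1` (from `(1−µ)^L ≤ 1/2`). [cite: CharikarMakarychevMakarychev2010, Lemma 3.4 (p. 16)] -/
theorem L_pos (hq : (1 - μ) ^ L ≤ 1 / 2) : 1 ≤ L := by
  by_contra h
  have hL : L = 0 := by omega
  subst hL
  norm_num at hq

omit [Fintype V] in
/-- The three blocks have the printed sizes: `|P₁| = |P₃| = L`. [cite: CharikarMakarychevMakarychev2010, Lemma 3.4 proof (p. 16: "each of length at least L")] -/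
theorem card_blocks (ha : ∀ i j, i ≤ m → j ≤ m → a i = a j → i = j) (hm : 3 * L ≤ m) :
    (seg a 0 L).card = L ∧ (seg a (m - L) m).card = L := by
  constructor
  · rw [card_seg ha (by omega)]; omega
  · rw [card_seg ha le_rfl]; omega

omit [Fintype V] in
/-- `q13 ≥ 0`. [cite: CharikarMakarychevMakarychev2010, Lemma 3.4 proof (p. 16)] -/
theorem q13_nonneg (hμ0 : 0 ≤ μ) (hμ1 : μ ≤ 1) (hq : (1 - μ) ^ L ≤ 1 / 2) (S : Finset (Sym2 V)) :
    0 ≤ q13 a m L μ S :=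
  Finset.sum_nonneg fun T₁ _ => Finset.sum_nonneg fun T₃ _ => by
    split_ifs
    · exact mul_nonneg (mul_nonneg (bern_nonneg hμ0 hμ1 _ _) (bern_nonneg hμ0 hμ1 _ _))
        (coupling_nonneg hq _ _)
    · exact le_rfl

omit [Fintype V] in
/-- `q2 ≥ 0`. [cite: CharikarMakarychevMakarychev2010, Lemma 3.4 proof (p. 16)] -/
theorem q2_nonneg (hμ0 : 0 ≤ μ) (hμ1 : μ ≤ 1) (S : Finset (Sym2 V)) : 0 ≤ q2 a m L μ S := by
  unfold q2; split_ifs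
  · exact bern_nonneg hμ0 hμ1 _ _
  · exact le_rfl

/-- `pathDist ≥ 0`. [cite: CharikarMakarychevMakarychev2010, Lemma 3.4 proof (p. 16)] -/
theorem pathDist_nonneg (hμ0 : 0 ≤ μ) (hμ1 : μ ≤ 1) (hq : (1 - μ) ^ L ≤ 1 / 2) (S : Finset (Sym2 V)) :
    0 ≤ pathDist a m L μ S :=
  prodU_nonneg (q13_nonneg hμ0 hμ1 hq) (q2_nonneg hμ0 hμ1) S

/-- **Total mass `1`** (the marginals of the coupling are probability distributions).
[cite: CharikarMakarychevMakarychev2010, Lemma 3.4 proof (p. 16)] -/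
theorem sum_pathDist (ha : ∀ i j, i ≤ m → j ≤ m → a i = a j → i = j) (hq : (1 - μ) ^ L ≤ 1 / 2) (hm : 3 * L ≤ m) :
    ∑ S, pathDist a m L μ S = 1 := by
  have h := sum_pathDist_mul (a := a) (m := m) (L := L) (μ := μ) (fun _ => 1)
  simp only [mul_one] at h
  rw [h]
  simp_rw [sum_bern, mul_one]
  have h3 : (1 - μ) ^ (seg a (m - L) m).card = (1 - μ) ^ L := by rw [(card_blocks ha hm).2]
  simp_rw [mul_assoc, ← Finset.mul_sum, sum_bern_coupling hq h3, mul_one, sum_bern]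

/-- **Support of the path distribution**: every multicut of positive weight is `T₁ ∪ T₃ ∪ T₂` with
`T_i` inside block `i` and `T₁, T₃` not both empty ("we add to `S` at least one edge either from `P₁`
or from `P₃`"). [cite: CharikarMakarychevMakarychev2010, Lemma 3.4 proof (p. 16)] -/
theorem pathDist_support {S : Finset (Sym2 V)} (hS : pathDist a m L μ S ≠ 0) :
    ∃ T₁ T₃ T₂ : Finset (Sym2 V), T₁ ⊆ seg a 0 L ∧ T₃ ⊆ seg a (m - L) m ∧ T₂ ⊆ seg a L (m - L) ∧
      S = T₁ ∪ T₃ ∪ T₂ ∧ (T₁ ≠ ∅ ∨ T₃ ≠ ∅) := by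
  obtain ⟨S', S₂, rfl, h13, h2⟩ := exists_of_prodU_ne_zero hS
  obtain ⟨T₁, hT₁, h1⟩ := Finset.exists_ne_zero_of_sum_ne_zero h13
  obtain ⟨T₃, hT₃, h3⟩ := Finset.exists_ne_zero_of_sum_ne_zero h1
  split_ifs at h3 with hS'
  · refine ⟨T₁, T₃, S₂, mem_powerset.1 hT₁, mem_powerset.1 hT₃, ?_, by rw [hS'], ?_⟩
    · unfold q2 at h2
      by_cases h : S₂ ⊆ seg a L (m - L)
      · exact h
      · rw [if_neg h] at h2; exact absurd rfl h2
    · by_contra hcon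
      push Not at hcon
      apply h3
      rw [hcon.1, hcon.2]
      simp [coupling]
  · exact absurd rfl h3

/-- Multicuts of positive weight lie inside the path. [cite: CharikarMakarychevMakarychev2010, Lemma 3.4 proof (p. 16)] -/
theorem pathDist_subset (hm : 3 * L ≤ m) {S : Finset (Sym2 V)} (hS : pathDist a m L μ S ≠ 0) :
    S ⊆ pathEdges a m := by
  obtain ⟨T₁, T₃, T₂, h1, h3, h2, rfl, -⟩ := pathDist_support hS
  rw [pathEdges_eq_seg]
  refine union_subset (union_subset (h1.trans (seg_subset_seg le_rfl (by omega)))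
    (h3.trans (seg_subset_seg (by omega) le_rfl))) (h2.trans (seg_subset_seg (by omega) (by omega)))

/-- **The endpoints are always separated**: every multicut of positive weight removes a path edge.
[cite: CharikarMakarychevMakarychev2010, Lemma 3.4 (p. 16: "the endpoints of the path are separated with probability 1")] -/
theorem pathDist_cut (hm : 3 * L ≤ m) {S : Finset (Sym2 V)} (hS : pathDist a m L μ S ≠ 0) :
    pathEdges a m \ S ≠ pathEdges a m := by
  obtain ⟨T₁, T₃, T₂, h1, h3, h2, rfl, hne⟩ := pathDist_support hS
  obtain ⟨e, he⟩ : ∃ e, e ∈ T₁ ∪ T₃ := by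
    rcases hne with h | h
    · obtain ⟨e, he⟩ := nonempty_iff_ne_empty.2 h; exact ⟨e, mem_union_left _ he⟩
    · obtain ⟨e, he⟩ := nonempty_iff_ne_empty.2 h; exact ⟨e, mem_union_right _ he⟩
  have heP : e ∈ pathEdges a m := by
    rw [pathEdges_eq_seg]
    rcases mem_union.1 he with he | he
    · exact seg_subset_seg le_rfl (by omega) (h1 he)
    · exact seg_subset_seg (by omega) le_rfl (h3 he)
  intro h
  have : e ∈ pathEdges a m \ (T₁ ∪ T₃ ∪ T₂) := h.symm ▸ heP
  rw [mem_sdiff] at this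
  exact this.2 (mem_union_left _ he)

/-- **Window probabilities, left/middle part**: a set of edges `W` inside the first two blocks is
untouched by the multicut with probability `(1−µ)^{|W|}` ("all our choices for the edges between `u`
and `v` are independent"). [cite: CharikarMakarychevMakarychev2010, Lemma 3.4 proof (p. 16–17)] -/
theorem sum_pathDist_disjoint_left (ha : ∀ i j, i ≤ m → j ≤ m → a i = a j → i = j) (hq : (1 - μ) ^ L ≤ 1 / 2) (hm : 3 * L ≤ m)
    {W : Finset (Sym2 V)} (hW : W ⊆ seg a 0 (m - L)) :
    ∑ S, pathDist a m L μ S * (if Disjoint W S then 1 else 0) = (1 - μ) ^ W.card := by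
  rw [sum_pathDist_mul]
  have hcard := card_blocks ha hm
  have hW3 : ∀ T₃, T₃ ⊆ seg a (m - L) m → Disjoint W T₃ := fun T₃ hT₃ =>
    (disjoint_seg ha (le_refl (m - L)) le_rfl).mono hW hT₃
  -- inner sum over the middle block
  have hinner : ∀ T₁ T₃, T₃ ⊆ seg a (m - L) m →
      ∑ T₂ ∈ (seg a L (m - L)).powerset, bern μ (seg a L (m - L)) T₂ *
        (if Disjoint W (T₁ ∪ T₃ ∪ T₂) then (1:ℝ) else 0) =
      (if Disjoint W T₁ then 1 else 0) * (1 - μ) ^ (W ∩ seg a L (m - L)).card := by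
    intro T₁ T₃ hT₃
    rw [← sum_bern_disjoint' μ (seg a L (m - L)) W, Finset.mul_sum]
    refine Finset.sum_congr rfl fun T₂ _ => ?_
    by_cases h1 : Disjoint W T₁ <;> by_cases h2 : Disjoint W T₂ <;>
      simp [h1, h2, disjoint_union_right, hW3 T₃ hT₃]
  rw [Finset.sum_congr rfl fun T₁ hT₁ => Finset.sum_congr rfl fun T₃ hT₃ => by
    rw [hinner T₁ T₃ (mem_powerset.1 hT₃)]]
  -- now the coupling marginal and the first block
  have h3 : (1 - μ) ^ (seg a (m - L) m).card = (1 - μ) ^ L := by rw [hcard.2]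
  have hrw : ∀ T₁ ∈ (seg a 0 L).powerset,
      ∑ T₃ ∈ (seg a (m - L) m).powerset, bern μ (seg a 0 L) T₁ * bern μ (seg a (m - L) m) T₃ *
        coupling ((1 - μ) ^ L) T₁ T₃ * ((if Disjoint W T₁ then 1 else 0) * (1 - μ) ^ (W ∩ seg a L (m - L)).card) =
      (bern μ (seg a 0 L) T₁ * (if Disjoint W T₁ then 1 else 0)) * (1 - μ) ^ (W ∩ seg a L (m - L)).card := by
    intro T₁ _
    have : ∀ T₃, bern μ (seg a 0 L) T₁ * bern μ (seg a (m - L) m) T₃ * coupling ((1 - μ) ^ L) T₁ T₃ *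
        ((if Disjoint W T₁ then 1 else 0) * (1 - μ) ^ (W ∩ seg a L (m - L)).card) =
        (bern μ (seg a 0 L) T₁ * (if Disjoint W T₁ then 1 else 0) * (1 - μ) ^ (W ∩ seg a L (m - L)).card) *
        (bern μ (seg a (m - L) m) T₃ * coupling ((1 - μ) ^ L) T₁ T₃) := fun _ => by ring
    rw [Finset.sum_congr rfl fun T₃ _ => this T₃, ← Finset.mul_sum, sum_bern_coupling hq h3, mul_one]
  rw [Finset.sum_congr rfl hrw, ← Finset.sum_mul, sum_bern_disjoint', ← pow_add]
  congr 1
  rw [← card_union_of_disjoint ((disjoint_seg ha (le_refl L) (by omega)).mono inter_subset_right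
    inter_subset_right), ← inter_union_distrib_left]
  congr 1
  refine inter_eq_left.2 (hW.trans fun e he => ?_)
  obtain ⟨k, hk1, hk2, rfl⟩ := mem_seg.1 he
  by_cases hk : k < L
  · exact mem_union_left _ (mem_seg.2 ⟨k, hk1, hk, rfl⟩)
  · exact mem_union_right _ (mem_seg.2 ⟨k, by omega, hk2, rfl⟩)

/-- **Window probabilities, middle/right part** (symmetric to the previous lemma).
[cite: CharikarMakarychevMakarychev2010, Lemma 3.4 proof (p. 16–17)] -/
theorem sum_pathDist_disjoint_right (ha : ∀ i j, i ≤ m → j ≤ m → a i = a j → i = j) (hq : (1 - μ) ^ L ≤ 1 / 2) (hm : 3 * L ≤ m)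
    {W : Finset (Sym2 V)} (hW : W ⊆ seg a L m) :
    ∑ S, pathDist a m L μ S * (if Disjoint W S then 1 else 0) = (1 - μ) ^ W.card := by
  rw [sum_pathDist_mul]
  have hcard := card_blocks ha hm
  have hW1 : ∀ T₁, T₁ ⊆ seg a 0 L → Disjoint W T₁ := fun T₁ hT₁ =>
    ((disjoint_seg ha (le_refl L) le_rfl).mono hT₁ hW).symm
  have hinner : ∀ T₁ T₃, T₁ ⊆ seg a 0 L →
      ∑ T₂ ∈ (seg a L (m - L)).powerset, bern μ (seg a L (m - L)) T₂ *
        (if Disjoint W (T₁ ∪ T₃ ∪ T₂) then (1:ℝ) else 0) =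
      (if Disjoint W T₃ then 1 else 0) * (1 - μ) ^ (W ∩ seg a L (m - L)).card := by
    intro T₁ T₃ hT₁
    rw [← sum_bern_disjoint' μ (seg a L (m - L)) W, Finset.mul_sum]
    refine Finset.sum_congr rfl fun T₂ _ => ?_
    by_cases h1 : Disjoint W T₃ <;> by_cases h2 : Disjoint W T₂ <;>
      simp [h1, h2, disjoint_union_right, hW1 T₁ hT₁]
  rw [Finset.sum_congr rfl fun T₁ hT₁ => Finset.sum_congr rfl fun T₃ hT₃ => by
    rw [hinner T₁ T₃ (mem_powerset.1 hT₁)]]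
  rw [Finset.sum_comm]
  have h1 : (1 - μ) ^ (seg a 0 L).card = (1 - μ) ^ L := by rw [hcard.1]
  have hrw : ∀ T₃ ∈ (seg a (m - L) m).powerset,
      ∑ T₁ ∈ (seg a 0 L).powerset, bern μ (seg a 0 L) T₁ * bern μ (seg a (m - L) m) T₃ *
        coupling ((1 - μ) ^ L) T₁ T₃ * ((if Disjoint W T₃ then 1 else 0) * (1 - μ) ^ (W ∩ seg a L (m - L)).card) =
      (bern μ (seg a (m - L) m) T₃ * (if Disjoint W T₃ then 1 else 0)) * (1 - μ) ^ (W ∩ seg a L (m - L)).card := by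
    intro T₃ _
    have : ∀ T₁, bern μ (seg a 0 L) T₁ * bern μ (seg a (m - L) m) T₃ * coupling ((1 - μ) ^ L) T₁ T₃ *
        ((if Disjoint W T₃ then 1 else 0) * (1 - μ) ^ (W ∩ seg a L (m - L)).card) =
        (bern μ (seg a (m - L) m) T₃ * (if Disjoint W T₃ then 1 else 0) * (1 - μ) ^ (W ∩ seg a L (m - L)).card) *
        (bern μ (seg a 0 L) T₁ * coupling ((1 - μ) ^ L) T₃ T₁) := fun T₁ => by rw [coupling_comm]; ring
    rw [Finset.sum_congr rfl fun T₁ _ => this T₁, ← Finset.mul_sum, sum_bern_coupling hq h1, mul_one]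
  rw [Finset.sum_congr rfl hrw, ← Finset.sum_mul, sum_bern_disjoint', ← pow_add]
  congr 1
  rw [add_comm, ← card_union_of_disjoint ((disjoint_seg ha (le_refl (m - L)) le_rfl).mono inter_subset_right
    inter_subset_right), ← inter_union_distrib_left]
  congr 1
  refine inter_eq_left.2 (hW.trans fun e he => ?_)
  obtain ⟨k, hk1, hk2, rfl⟩ := mem_seg.1 he
  by_cases hk : k < m - L
  · exact mem_union_left _ (mem_seg.2 ⟨k, hk1, hk, rfl⟩)
  · exact mem_union_right _ (mem_seg.2 ⟨k, by omega, hk2, rfl⟩)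

/-- **A window of length `≤ L` is uncut with probability exactly `(1−µ)^{length}`** (it fits inside
`P₁ ∪ P₂` or inside `P₂ ∪ P₃`). [cite: CharikarMakarychevMakarychev2010, Lemma 3.4 proof (p. 16–17)] -/
theorem sum_pathDist_disjoint_seg (ha : ∀ i j, i ≤ m → j ≤ m → a i = a j → i = j) (hq : (1 - μ) ^ L ≤ 1 / 2) (hm : 3 * L ≤ m)
    {lo hi : ℕ} (hlo : lo ≤ hi) (hhi : hi ≤ m) (hlen : hi - lo ≤ L) :
    ∑ S, pathDist a m L μ S * (if Disjoint (seg a lo hi) S then 1 else 0) = (1 - μ) ^ (hi - lo) := by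
  rw [← card_seg ha hhi (lo := lo)]
  by_cases h : hi ≤ m - L
  · exact sum_pathDist_disjoint_left ha hq hm (seg_subset_seg le_rfl h |>.trans
      (seg_subset_seg (Nat.zero_le lo) le_rfl))
  · exact sum_pathDist_disjoint_right ha hq hm (seg_subset_seg (by omega) hhi)

/-- **A window longer than `L` is uncut with probability `≤ (1−µ)^L`** (it contains a window of
length `L`). [cite: CharikarMakarychevMakarychev2010, Lemma 3.4 proof (p. 17: "Pr ≥ 1 − (1 − µ)^L")] -/
theorem sum_pathDist_disjoint_seg_le (ha : ∀ i j, i ≤ m → j ≤ m → a i = a j → i = j) (hμ0 : 0 ≤ μ) (hμ1 : μ ≤ 1) (hq : (1 - μ) ^ L ≤ 1 / 2) (hm : 3 * L ≤ m)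
    {lo hi : ℕ} (hhi : hi ≤ m) (hlen : L < hi - lo) :
    ∑ S, pathDist a m L μ S * (if Disjoint (seg a lo hi) S then 1 else 0) ≤ (1 - μ) ^ L := by
  have hsub : seg a lo (lo + L) ⊆ seg a lo hi := seg_subset_seg le_rfl (by omega)
  calc ∑ S, pathDist a m L μ S * (if Disjoint (seg a lo hi) S then 1 else 0)
      ≤ ∑ S, pathDist a m L μ S * (if Disjoint (seg a lo (lo + L)) S then 1 else 0) := by
        refine Finset.sum_le_sum fun S _ => mul_le_mul_of_nonneg_left ?_ (pathDist_nonneg hμ0 hμ1 hq S)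
        by_cases h : Disjoint (seg a lo hi) S
        · rw [if_pos h, if_pos (h.mono_left hsub)]
        · rw [if_neg h]; split_ifs <;> norm_num
    _ = (1 - μ) ^ L := by
        have := sum_pathDist_disjoint_seg ha hq hm (lo := lo) (hi := lo + L) (by omega) (by omega)
          (by omega)
        simpa using this

omit [Fintype V] in
/-- Vertices covered by (a subset of) the path edges are path vertices. [cite: CharikarMakarychevMakarychev2010, Lemma 3.4 (p. 16)] -/
theorem exists_index_of_mem_supp {B : Finset (Sym2 V)} (hB : B ⊆ pathEdges a m) {u : V}
    (hu : u ∈ supp B) : ∃ i, i ≤ m ∧ u = a i := by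
  obtain ⟨e, he, hue⟩ := mem_supp.1 hu
  obtain ⟨k, hk, rfl⟩ := mem_pathEdges.1 (hB he)
  rcases Sym2.mem_iff.1 hue with rfl | rfl
  · exact ⟨k, hk.le, rfl⟩
  · exact ⟨k + 1, by omega, rfl⟩

/-- For a multicut `S` inside the path, `a_i ~ a_j` in `P ∖ S` iff the window `[i,j)` misses `S`.
[cite: CharikarMakarychevMakarychev2010, Lemma 3.4 proof (p. 17)] -/
theorem jind_path_eq (ha : ∀ i j, i ≤ m → j ≤ m → a i = a j → i = j) {S : Finset (Sym2 V)} {i j : ℕ} (hij : i ≤ j) (hj : j ≤ m) :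
    jind (pathEdges a m \ S) (a i) (a j) = if Disjoint (seg a i j) S then 1 else 0 := by
  have hB : pathEdges a m \ S ⊆ pathEdges a m := sdiff_subset
  have key := edist_in_path ha hB hij hj
  by_cases h : Disjoint (seg a i j) S
  · rw [if_pos h]
    have hall : ∀ k, i ≤ k → k < j → ek a k ∈ pathEdges a m \ S := fun k hk1 hk2 =>
      mem_sdiff.2 ⟨edge_mem_pathEdges (by omega), disjoint_seg_iff.1 h k hk1 hk2⟩
    exact jind_of_reachable (reachable_of_edist_ne_top (by rw [key.1 hall]; exact ENat.coe_ne_top _))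
  · rw [if_neg h]
    refine jind_of_not_reachable (key.2 ?_)
    rw [disjoint_seg_iff] at h
    push Not at h
    obtain ⟨k, hk1, hk2, hkS⟩ := h
    exact ⟨k, hk1, hk2, fun h' => (mem_sdiff.1 h').2 hkS⟩

/-- `Pr[a_i ~ a_j]` is the probability that the window `[i,j)` is uncut.
[cite: CharikarMakarychevMakarychev2010, Lemma 3.4 proof (p. 17)] -/
theorem jointProb_path_eq (ha : ∀ i j, i ≤ m → j ≤ m → a i = a j → i = j) {i j : ℕ} (hij : i ≤ j) (hj : j ≤ m) :
    jointProb (pathDist a m L μ) (pathEdges a m) (a i) (a j) =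
      ∑ S, pathDist a m L μ S * (if Disjoint (seg a i j) S then 1 else 0) := by
  unfold jointProb
  exact Finset.sum_congr rfl fun S _ => by rw [jind_path_eq ha hij hj]

/-- **Lemma 3.4: the coupled coin distribution is a good multicut distribution of the path.**
[cite: CharikarMakarychevMakarychev2010, Lemma 3.4 (p. 16–17)] -/
theorem GoodMulticut.path (ha : ∀ i j, i ≤ m → j ≤ m → a i = a j → i = j) (hμ0 : 0 ≤ μ) (hμ1 : μ ≤ 1)
    (hq : (1 - μ) ^ L ≤ 1 / 2) (hm : 3 * L ≤ m) : GoodMulticut μ L (pathEdges a m) (pathDist a m L μ) := by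
  have hP : pathEdges a m ⊆ pathEdges a m := Subset.rfl
  -- distances in the full path
  have hdist : ∀ i j, i ≤ j → j ≤ m → (gr (pathEdges a m)).edist (a i) (a j) = (j - i : ℕ) :=
    fun i j hij hj => (edist_in_path ha hP hij hj).1 fun k _ hk => edge_mem_pathEdges (by omega)
  -- a reachable pair of distinct vertices consists of two path vertices
  have hpair : ∀ u v : V, u ≠ v → (gr (pathEdges a m)).Reachable u v →
      ∃ i j, i ≤ m ∧ j ≤ m ∧ u = a i ∧ v = a j := by
    intro u v huv hr
    obtain ⟨i, hi, rfl⟩ := exists_index_of_mem_supp hP (mem_supp_of_reachable_ne hr huv)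
    obtain ⟨j, hj, rfl⟩ := exists_index_of_mem_supp hP
      (mem_supp_of_reachable_ne hr.symm (Ne.symm huv))
    exact ⟨i, j, hi, hj, rfl, rfl⟩
  -- the `exact` field for ordered indices
  have hexact : ∀ i j, i ≤ j → j ≤ m → j - i ≤ L →
      jointProb (pathDist a m L μ) (pathEdges a m) (a i) (a j) = (1 - μ) ^ (j - i) := by
    intro i j hij hj hlen
    rw [jointProb_path_eq ha hij hj]
    exact sum_pathDist_disjoint_seg ha hq hm hij hj hlen
  have hfar : ∀ i j, i ≤ j → j ≤ m → L < j - i →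
      jointProb (pathDist a m L μ) (pathEdges a m) (a i) (a j) ≤ (1 - μ) ^ L := by
    intro i j hij hj hlen
    rw [jointProb_path_eq ha hij hj]
    exact sum_pathDist_disjoint_seg_le ha hμ0 hμ1 hq hm hj hlen
  have h1μ : 0 ≤ 1 - μ := by linarith
  refine ⟨pathDist_nonneg hμ0 hμ1 hq, sum_pathDist ha hq hm,
    fun S hS => pathDist_subset hm hS, fun S hS => ?_, fun u v k hk hkL => ?_,
    fun S u v hS hd hr => ?_, fun u v hfar' => ?_⟩
  · -- acyclic: the path is always cut
    have h := isAcyclic_attachedPath (D := ∅) (B := pathEdges a m \ S) ha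
      (fun k _ _ h => by simp [mem_supp] at h) sdiff_subset (pathDist_cut hm hS)
      (by have := L_pos hq; omega) isAcyclic_gr_empty
    rwa [empty_union] at h
  · -- exact
    by_cases huv : u = v
    · subst huv
      rw [SimpleGraph.edist_self] at hk
      have : k = 0 := by exact_mod_cast hk.symm
      subst this
      rw [pow_zero]
      unfold jointProb; simp_rw [jind_self, mul_one]; exact sum_pathDist ha hq hm
    · obtain ⟨i, j, hi, hj, rfl, rfl⟩ := hpair u v huv
        (reachable_of_edist_ne_top (by rw [hk]; exact ENat.coe_ne_top k))
      rcases le_total i j with hij | hji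
      · rw [hdist i j hij hj] at hk
        have : k = j - i := by exact_mod_cast hk.symm
        subst this
        exact hexact i j hij hj hkL
      · rw [SimpleGraph.edist_comm, hdist j i hji hi] at hk
        have : k = i - j := by exact_mod_cast hk.symm
        subst this
        rw [jointProb_comm]
        exact hexact j i hji hi hkL
  · -- geodesic
    by_cases huv : u = v
    · subst huv; simp
    · obtain ⟨i, j, hi, hj, rfl, rfl⟩ := hpair u v huv (hr.mono (gr_mono sdiff_subset))
      have hB : pathEdges a m \ S ⊆ pathEdges a m := sdiff_subset
      rcases le_total i j with hij | hji
      · obtain ⟨w⟩ := hr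
        have hall := (walk_in_path ha hB w i j hi hj rfl rfl).2
        rw [show min i j = i by omega, show max i j = j by omega] at hall
        rw [(edist_in_path ha hB hij hj).1 hall, hdist i j hij hj]
      · obtain ⟨w⟩ := hr.symm
        have hall := (walk_in_path ha hB w j i hj hi rfl rfl).2
        rw [show min j i = j by omega, show max j i = i by omega] at hall
        rw [SimpleGraph.edist_comm, (edist_in_path ha hB hji hi).1 hall, SimpleGraph.edist_comm,
          hdist j i hji hi]
  · -- far
    by_cases huv : u = v
    · subst huv; simp at hfar'
    by_cases hr : (gr (pathEdges a m)).Reachable u v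
    · obtain ⟨i, j, hi, hj, rfl, rfl⟩ := hpair u v huv hr
      rcases le_total i j with hij | hji
      · rw [hdist i j hij hj] at hfar'
        exact hfar i j hij hj (by exact_mod_cast hfar')
      · rw [SimpleGraph.edist_comm, hdist j i hji hi] at hfar'
        rw [jointProb_comm]
        exact hfar j i hji hi (by exact_mod_cast hfar')
    · -- never joined
      have : jointProb (pathDist a m L μ) (pathEdges a m) u v = 0 := by
        unfold jointProb
        refine Finset.sum_eq_zero fun S _ => ?_
        rw [jind_of_not_reachable fun h => hr (h.mono (gr_mono sdiff_subset)), mul_zero]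
      rw [this]
      exact pow_nonneg h1μ _

end Lemma34
end Path

/-! ### Case 3 of the proof: attaching a long path -/

section Ear

variable {μ : ℝ} {L : ℕ}

/-- The independent union is associative. [cite: CharikarMakarychevMakarychev2010, Thm 3.3 proof (p. 17–18)] -/
theorem prodU_assoc (p q r : Finset (Sym2 V) → ℝ) : prodU p (prodU q r) = prodU (prodU p q) r := by
  funext S
  -- both sides equal the triple sum
  have h3 : ∀ f : Finset (Sym2 V) → ℝ, ∑ S, prodU p (prodU q r) S * f S =
      ∑ S₁, ∑ S₂, ∑ S₃, p S₁ * q S₂ * r S₃ * f (S₁ ∪ S₂ ∪ S₃) := by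
    intro f
    rw [sum_prodU_mul]
    refine Finset.sum_congr rfl fun S₁ _ => ?_
    have := sum_prodU_mul q r (fun T => p S₁ * f (S₁ ∪ T))
    have lhs : ∑ S₂, p S₁ * prodU q r S₂ * f (S₁ ∪ S₂) = ∑ T, prodU q r T * (p S₁ * f (S₁ ∪ T)) :=
      Finset.sum_congr rfl fun T _ => by ring
    rw [lhs, this]
    refine Finset.sum_congr rfl fun S₂ _ => Finset.sum_congr rfl fun S₃ _ => ?_
    rw [union_assoc]; ring
  have h3' : ∀ f : Finset (Sym2 V) → ℝ, ∑ S, prodU (prodU p q) r S * f S =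
      ∑ S₁, ∑ S₂, ∑ S₃, p S₁ * q S₂ * r S₃ * f (S₁ ∪ S₂ ∪ S₃) := by
    intro f
    rw [sum_prodU_mul]
    calc ∑ T, ∑ S₃, prodU p q T * r S₃ * f (T ∪ S₃)
        = ∑ S₃, ∑ T, prodU p q T * (r S₃ * f (T ∪ S₃)) := by
          rw [Finset.sum_comm]; refine Finset.sum_congr rfl fun _ _ => Finset.sum_congr rfl fun _ _ => ?_; ring
      _ = ∑ S₃, ∑ S₁, ∑ S₂, p S₁ * q S₂ * (r S₃ * f (S₁ ∪ S₂ ∪ S₃)) := by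
          refine Finset.sum_congr rfl fun S₃ _ => ?_
          rw [sum_prodU_mul]
      _ = ∑ S₁, ∑ S₂, ∑ S₃, p S₁ * q S₂ * r S₃ * f (S₁ ∪ S₂ ∪ S₃) := by
          rw [Finset.sum_comm]
          refine Finset.sum_congr rfl fun S₁ _ => ?_
          rw [Finset.sum_comm]
          refine Finset.sum_congr rfl fun S₂ _ => Finset.sum_congr rfl fun S₃ _ => ?_
          ring
  have e1 := h3 (fun T => if T = S then 1 else 0)
  have e2 := h3' (fun T => if T = S then 1 else 0)
  simp only [mul_ite, mul_one, mul_zero, Finset.sum_ite_eq', Finset.mem_univ, if_true] at e1 e2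
  rw [e1, e2]

variable {a : ℕ → V} {n : ℕ}

omit [Fintype V] in
/-- A shifted sub-path is a segment. [cite: CharikarMakarychevMakarychev2010, Thm 3.3 proof, case 3 (p. 18: "Subdivide P into three pieces")] -/
theorem pathEdges_shift (a : ℕ → V) (lo len : ℕ) :
    pathEdges (fun k => a (lo + k)) len = seg a lo (lo + len) := by
  ext e
  simp only [mem_pathEdges, mem_seg, ek]
  constructor
  · rintro ⟨k, hk, rfl⟩
    exact ⟨lo + k, by omega, by omega, by rw [show lo + k + 1 = lo + (k + 1) by omega]⟩
  · rintro ⟨k, hk1, hk2, rfl⟩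
    refine ⟨k - lo, by omega, ?_⟩
    rw [show lo + (k - lo) = k by omega, show lo + (k - lo + 1) = k + 1 by omega]

omit [Fintype V] [DecidableEq V] in
/-- Injectivity of `a` on `[0, n]` descends to the shifted path. [cite: CharikarMakarychevMakarychev2010, Thm 3.3 proof, case 3 (p. 18)] -/
theorem shift_inj (ha : ∀ i j, i ≤ n → j ≤ n → a i = a j → i = j) {lo len : ℕ} (h : lo + len ≤ n) :
    ∀ i j, i ≤ len → j ≤ len → (fun k => a (lo + k)) i = (fun k => a (lo + k)) j → i = j :=
  fun i j hi hj hij => by have := ha (lo + i) (lo + j) (by omega) (by omega) hij; omega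

/-- **The pendant step**: attaching to a good `E₀` an always-cut path whose interior avoids
`supp E₀` does not change, for pairs of non-interior vertices, the probability of not being
separated, the distances up to `L`, nor the surviving geodesics.
[cite: CharikarMakarychevMakarychev2010, Thm 3.3 proof, case 3 (p. 18: "Since A₃ is always cut by S, the multicut S separates u and v in G if and only if the multicut S_H ∪ S₁ ∪ S₂ separates them in H ∪ A₁ ∪ A₂")] -/
theorem attach_fields {E₀ : Finset (Sym2 V)} {p₀ pB : Finset (Sym2 V) → ℝ}
    (hE₀ : GoodMulticut μ L E₀ p₀) {b : ℕ → V} {n : ℕ}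
    (hb : ∀ i j, i ≤ n → j ≤ n → b i = b j → i = j) (hn2 : 2 ≤ n) (hnL : L < n)
    (hint : ∀ k, 0 < k → k < n → b k ∉ supp E₀)
    (hpB1 : ∑ S, pB S = 1) (hpBsub : ∀ S, pB S ≠ 0 → S ⊆ pathEdges b n)
    (hpBcut : ∀ S, pB S ≠ 0 → pathEdges b n \ S ≠ pathEdges b n)
    {u v : V} (hu : ∀ k, 0 < k → k < n → b k ≠ u) (hv : ∀ k, 0 < k → k < n → b k ≠ v) :
    (∀ k : ℕ, (gr (E₀ ∪ pathEdges b n)).edist u v = k → k ≤ L →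
      jointProb (prodU p₀ pB) (E₀ ∪ pathEdges b n) u v = (1 - μ) ^ k) ∧
    ((L : ℕ∞) < (gr (E₀ ∪ pathEdges b n)).edist u v →
      jointProb (prodU p₀ pB) (E₀ ∪ pathEdges b n) u v ≤ (1 - μ) ^ L) ∧
    (∀ S₀ T, p₀ S₀ ≠ 0 → pB T ≠ 0 → (gr (E₀ ∪ pathEdges b n)).edist u v ≤ L →
      (gr ((E₀ ∪ pathEdges b n) \ (S₀ ∪ T))).Reachable u v →
      (gr ((E₀ ∪ pathEdges b n) \ (S₀ ∪ T))).edist u v = (gr (E₀ ∪ pathEdges b n)).edist u v) := by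
  have hdisj : Disjoint E₀ (pathEdges b n) := by
    rw [Finset.disjoint_right]
    intro e he
    obtain ⟨k, hk, rfl⟩ := mem_pathEdges.1 he
    exact pathEdge_notMem hint hn2 hk
  -- cut graphs: the attached path misses an edge, so it changes nothing off its interior
  have hint' : ∀ S₀, ∀ k, 0 < k → k < n → b k ∉ supp (E₀ \ S₀) := fun S₀ k hk hkn h =>
    hint k hk hkn (supp_mono sdiff_subset h)
  have hcut : ∀ S₀ T, p₀ S₀ ≠ 0 → pB T ≠ 0 →
      (gr ((E₀ ∪ pathEdges b n) \ (S₀ ∪ T))).edist u v = (gr (E₀ \ S₀)).edist u v := by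
    intro S₀ T h₀ hT
    rw [union_sdiff_union hdisj (hE₀.subset S₀ h₀) (hpBsub T hT)]
    exact edist_attachedPath_of_ne hb (hint' S₀) sdiff_subset (hpBcut T hT) hn2 hu hv
  -- the probability of not being separated is that of `E₀`
  have hJ : jointProb (prodU p₀ pB) (E₀ ∪ pathEdges b n) u v = jointProb p₀ E₀ u v := by
    unfold jointProb
    rw [sum_prodU_mul]
    rw [sum_sum_congr_support (pA := p₀) (pB := pB) _ (fun S₀ _ => jind (E₀ \ S₀) u v) fun S₀ T h₀ hT =>
      jind_congr (by rw [← edist_ne_top_iff_reachable, ← edist_ne_top_iff_reachable, hcut S₀ T h₀ hT])]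
    refine Finset.sum_congr rfl fun S₀ _ => ?_
    have hterm : ∀ T, p₀ S₀ * pB T * jind (E₀ \ S₀) u v = p₀ S₀ * jind (E₀ \ S₀) u v * pB T :=
      fun _ => by ring
    rw [Finset.sum_congr rfl fun T _ => hterm T, ← Finset.mul_sum, hpB1, mul_one]
  -- distances up to `L` are those of `E₀`
  have hle : (gr (E₀ ∪ pathEdges b n)).edist u v ≤ (gr E₀).edist u v := edist_anti_of_subset subset_union_left u v
  have hge : min ((gr E₀).edist u v) n ≤ (gr (E₀ ∪ pathEdges b n)).edist u v :=
    min_edist_le_edist_attachedPath hb hint Subset.rfl hn2 hu hv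
  have hnear : ∀ k : ℕ, (gr (E₀ ∪ pathEdges b n)).edist u v = k → k ≤ L → (gr E₀).edist u v = k := by
    intro k hk hkL
    rw [hk] at hle hge
    refine le_antisymm ?_ hle
    rcases min_le_iff.1 hge with h | h
    · exact h
    · exfalso
      have : n ≤ k := by exact_mod_cast h
      omega
  refine ⟨fun k hk hkL => ?_, fun hfar => ?_, fun S₀ T h₀ hT hd hr => ?_⟩
  · rw [hJ]; exact hE₀.exact u v k (hnear k hk hkL) hkL
  · rw [hJ]; exact hE₀.far u v (lt_of_lt_of_le hfar hle)
  · rw [hcut S₀ T h₀ hT]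
    rw [← edist_ne_top_iff_reachable, hcut S₀ T h₀ hT, edist_ne_top_iff_reachable] at hr
    -- `d(u,v) ≤ L` is finite, so `d_{E₀}(u,v) = d(u,v)`
    obtain ⟨k, hk⟩ := ENat.ne_top_iff_exists.1 (ne_top_of_le_ne_top (ENat.coe_ne_top L) hd)
    have hkL : k ≤ L := by rw [← hk] at hd; exact_mod_cast hd
    have h0 := hnear k hk.symm hkL
    rw [hE₀.geodesic S₀ u v h₀ (by rw [h0]; exact_mod_cast hkL) hr, h0, hk]

omit [Fintype V] in
/-- Support of a union of edge sets. [cite: CharikarMakarychevMakarychev2010, §3.1 (p. 15)] -/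
theorem mem_supp_union {A B : Finset (Sym2 V)} {x : V} : x ∈ supp (A ∪ B) ↔ x ∈ supp A ∨ x ∈ supp B := by
  simp only [mem_supp, mem_union]
  constructor
  · rintro ⟨e, he | he, hx⟩
    · exact Or.inl ⟨e, he, hx⟩
    · exact Or.inr ⟨e, he, hx⟩
  · rintro (⟨e, he, hx⟩ | ⟨e, he, hx⟩)
    · exact ⟨e, Or.inl he, hx⟩
    · exact ⟨e, Or.inr he, hx⟩

omit [Fintype V] in
/-- Vertices covered by a segment are `a_k`, `lo ≤ k ≤ hi`. [cite: CharikarMakarychevMakarychev2010, Thm 3.3 proof, case 3 (p. 18)] -/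
theorem exists_index_of_mem_supp_seg {lo hi : ℕ} (hlh : lo ≤ hi) {u : V} (hu : u ∈ supp (seg a lo hi)) :
    ∃ k, lo ≤ k ∧ k ≤ hi ∧ u = a k := by
  rw [← show lo + (hi - lo) = hi by omega, ← pathEdges_shift] at hu
  obtain ⟨k, hk, rfl⟩ := exists_index_of_mem_supp Subset.rfl hu
  exact ⟨lo + k, by omega, by omega, rfl⟩

/-- The multicut distribution of Lemma 3.4 on the piece `a_lo … a_hi` of the attached path.
[cite: CharikarMakarychevMakarychev2010, Thm 3.3 proof, case 3 (p. 18: "Let S_i be the multicut whose existence is guaranteed by Lemma 3.4 for the path A_i")] -/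
def pieceDist (a' : ℕ → V) (L' : ℕ) (μ' : ℝ) (lo hi : ℕ) : Finset (Sym2 V) → ℝ :=
  pathDist (fun k => a' (lo + k)) (hi - lo) L' μ'

/-- Each piece of length `≥ 3L` carries a good, always-cutting multicut distribution supported on it.
[cite: CharikarMakarychevMakarychev2010, Thm 3.3 proof, case 3 (p. 18) and Lemma 3.4 (p. 16)] -/
theorem piece_good (ha : ∀ i j, i ≤ n → j ≤ n → a i = a j → i = j) (hμ0 : 0 ≤ μ) (hμ1 : μ ≤ 1)
    (hq : (1 - μ) ^ L ≤ 1 / 2) {lo hi : ℕ} (hlen : 3 * L ≤ hi - lo) (hhi : hi ≤ n) (hlh : lo ≤ hi) :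
    GoodMulticut μ L (seg a lo hi) (pieceDist a L μ lo hi) ∧
    (∀ S, pieceDist a L μ lo hi S ≠ 0 → S ⊆ seg a lo hi) ∧
    (∀ S, pieceDist a L μ lo hi S ≠ 0 → seg a lo hi \ S ≠ seg a lo hi) := by
  have hb := shift_inj ha (lo := lo) (len := hi - lo) (by omega)
  have hseg : pathEdges (fun k => a (lo + k)) (hi - lo) = seg a lo hi := by
    rw [pathEdges_shift, show lo + (hi - lo) = hi by omega]
  refine ⟨?_, fun S hS => ?_, fun S hS => ?_⟩
  · have := GoodMulticut.path hb hμ0 hμ1 hq hlen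
    rwa [hseg] at this
  · have := pathDist_subset (a := fun k => a (lo + k)) hlen hS
    rwa [hseg] at this
  · have := pathDist_cut (a := fun k => a (lo + k)) hlen hS
    rwa [hseg] at this

/-- **Case 3 of Theorem 3.3: attaching a path of length `≥ 9L` along its endpoints to a good edge
set preserves goodness**, with the product of the three piece distributions of Lemma 3.4.
[cite: CharikarMakarychevMakarychev2010, Thm 3.3 proof, case 3 (p. 18)] -/
theorem GoodMulticut.ear {E' : Finset (Sym2 V)} {p' : Finset (Sym2 V) → ℝ}
    (ha : ∀ i j, i ≤ n → j ≤ n → a i = a j → i = j) (hμ0 : 0 ≤ μ) (hμ1 : μ ≤ 1)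
    (hq : (1 - μ) ^ L ≤ 1 / 2) (hn : 9 * L ≤ n) (hE' : GoodMulticut μ L E' p')
    (hint : ∀ k, 0 < k → k < n → a k ∉ supp E') :
    GoodMulticut μ L (E' ∪ pathEdges a n)
      (prodU p' (prodU (pieceDist a L μ 0 (3 * L)) (prodU (pieceDist a L μ (3 * L) (6 * L))
        (pieceDist a L μ (6 * L) n)))) := by
  have hL : 1 ≤ L := L_pos hq
  -- the three pieces
  set m₁ := 3 * L with hm₁
  set m₂ := 6 * L with hm₂
  set pd1 := pieceDist a L μ 0 m₁ with hpd1
  set pd2 := pieceDist a L μ m₁ m₂ with hpd2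
  set pd3 := pieceDist a L μ m₂ n with hpd3
  obtain ⟨G1, S1, C1⟩ := piece_good ha hμ0 hμ1 hq (lo := 0) (hi := m₁) (by omega) (by omega) (by omega)
  obtain ⟨G2, S2, C2⟩ := piece_good ha hμ0 hμ1 hq (lo := m₁) (hi := m₂) (by omega) (by omega) (by omega)
  obtain ⟨G3, S3, C3⟩ := piece_good ha hμ0 hμ1 hq (lo := m₂) (hi := n) (by omega) le_rfl (by omega)
  rw [← hpd1] at G1 S1 C1; rw [← hpd2] at G2 S2 C2; rw [← hpd3] at G3 S3 C3
  -- the whole path is the union of the pieces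
  have hP : pathEdges a n = seg a 0 m₁ ∪ seg a m₁ m₂ ∪ seg a m₂ n := by
    rw [pathEdges_eq_seg]; ext e; simp only [mem_union, mem_seg]
    constructor
    · rintro ⟨k, hk1, hk2, rfl⟩
      by_cases h1 : k < m₁
      · exact Or.inl (Or.inl ⟨k, hk1, h1, rfl⟩)
      by_cases h2 : k < m₂
      · exact Or.inl (Or.inr ⟨k, by omega, h2, rfl⟩)
      · exact Or.inr ⟨k, by omega, hk2, rfl⟩
    · rintro ((⟨k, hk1, hk2, rfl⟩ | ⟨k, hk1, hk2, rfl⟩) | ⟨k, hk1, hk2, rfl⟩) <;> exact ⟨k, by omega, by omega, rfl⟩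
  -- supports: interior indices of the big path avoid `E'`; segments cover index ranges
  have hsegE : ∀ lo hi, hi ≤ n → Disjoint E' (seg a lo hi) := by
    intro lo hi hhi
    rw [Finset.disjoint_right]
    intro e he
    obtain ⟨k, hk1, hk2, rfl⟩ := mem_seg.1 he
    exact pathEdge_notMem hint (by omega) (by omega)
  have hmeetE : ∀ lo hi, lo ≤ hi → hi ≤ n → ∀ x, x ∈ supp E' → x ∈ supp (seg a lo hi) →
      ∃ k, lo ≤ k ∧ k ≤ hi ∧ x = a k ∧ (k = 0 ∨ k = n) := by
    intro lo hi hlh hhi x hx hx'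
    obtain ⟨k, hk1, hk2, rfl⟩ := exists_index_of_mem_supp_seg hlh hx'
    refine ⟨k, hk1, hk2, rfl, ?_⟩
    by_contra hk; push Not at hk
    exact hint k (by omega) (by omega) hx
  have hmeetSeg : ∀ lo hi lo' hi', lo ≤ hi → hi ≤ lo' → lo' ≤ hi' → hi' ≤ n → ∀ x,
      x ∈ supp (seg a lo hi) → x ∈ supp (seg a lo' hi') → x = a hi ∧ hi = lo' := by
    intro lo hi lo' hi' h1 h2 h3 h4 x hx hx'
    obtain ⟨k, hk1, hk2, rfl⟩ := exists_index_of_mem_supp_seg h1 hx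
    obtain ⟨k', hk1', hk2', hkk⟩ := exists_index_of_mem_supp_seg h3 hx'
    have := ha k k' (by omega) (by omega) hkk
    exact ⟨by rw [show hi = k by omega], by omega⟩
  -- goodness of the reduced configurations
  have G12 : GoodMulticut μ L (seg a 0 m₁ ∪ seg a m₁ m₂) (prodU pd1 pd2) :=
    GoodMulticut.union hμ0 hμ1 (disjoint_seg ha le_rfl (by omega))
      (fun x h1 h2 => (hmeetSeg 0 m₁ m₁ m₂ (by omega) le_rfl (by omega) (by omega) x h1 h2).1) G1 G2
  have G23 : GoodMulticut μ L (seg a m₁ m₂ ∪ seg a m₂ n) (prodU pd2 pd3) :=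
    GoodMulticut.union hμ0 hμ1 (disjoint_seg ha le_rfl le_rfl)
      (fun x h1 h2 => (hmeetSeg m₁ m₂ m₂ n (by omega) le_rfl (by omega) le_rfl x h1 h2).1) G2 G3
  have R3 : GoodMulticut μ L (E' ∪ (seg a 0 m₁ ∪ seg a m₁ m₂)) (prodU p' (prodU pd1 pd2)) := by
    refine GoodMulticut.union (c := a 0) hμ0 hμ1 ?_ ?_ hE' G12
    · exact disjoint_union_right.2 ⟨hsegE 0 m₁ (by omega), hsegE m₁ m₂ (by omega)⟩
    · intro x hx hx'
      rcases mem_supp_union.1 hx' with h | h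
      · obtain ⟨k, hk1, hk2, rfl, hk⟩ := hmeetE 0 m₁ (by omega) (by omega) x hx h
        rcases hk with rfl | rfl
        · rfl
        · omega
      · obtain ⟨k, hk1, hk2, rfl, hk⟩ := hmeetE m₁ m₂ (by omega) (by omega) x hx h
        rcases hk with rfl | rfl <;> omega
  have R1 : GoodMulticut μ L (E' ∪ (seg a m₁ m₂ ∪ seg a m₂ n)) (prodU p' (prodU pd2 pd3)) := by
    refine GoodMulticut.union (c := a n) hμ0 hμ1 ?_ ?_ hE' G23
    · exact disjoint_union_right.2 ⟨hsegE m₁ m₂ (by omega), hsegE m₂ n le_rfl⟩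
    · intro x hx hx'
      rcases mem_supp_union.1 hx' with h | h
      · obtain ⟨k, hk1, hk2, rfl, hk⟩ := hmeetE m₁ m₂ (by omega) (by omega) x hx h
        rcases hk with rfl | rfl <;> omega
      · obtain ⟨k, hk1, hk2, rfl, hk⟩ := hmeetE m₂ n (by omega) le_rfl x hx h
        rcases hk with rfl | rfl
        · omega
        · rfl
  have R2 : GoodMulticut μ L ((E' ∪ seg a 0 m₁) ∪ seg a m₂ n) (prodU (prodU p' pd1) pd3) := by
    have R0 : GoodMulticut μ L (E' ∪ seg a 0 m₁) (prodU p' pd1) := by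
      refine GoodMulticut.union (c := a 0) hμ0 hμ1 (hsegE 0 m₁ (by omega)) ?_ hE' G1
      intro x hx hx'
      obtain ⟨k, hk1, hk2, rfl, hk⟩ := hmeetE 0 m₁ (by omega) (by omega) x hx hx'
      rcases hk with rfl | rfl
      · rfl
      · omega
    refine GoodMulticut.union (c := a n) hμ0 hμ1 ?_ ?_ R0 G3
    · exact disjoint_union_left.2 ⟨hsegE m₂ n le_rfl, disjoint_seg ha (by omega) le_rfl⟩
    · intro x hx hx'
      rcases mem_supp_union.1 hx with h | h
      · obtain ⟨k, hk1, hk2, rfl, hk⟩ := hmeetE m₂ n (by omega) le_rfl x h hx'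
        rcases hk with rfl | rfl
        · omega
        · rfl
      · have := (hmeetSeg 0 m₁ m₂ n (by omega) (by omega) (by omega) le_rfl x h hx').2
        omega
  -- the three ways of writing `E` and `p` as "reduced configuration + attached piece"
  have hb3 := shift_inj ha (lo := m₂) (len := n - m₂) (by omega)
  have hb1 := shift_inj ha (lo := 0) (len := m₁ - 0) (by omega)
  have hb2 := shift_inj ha (lo := m₁) (len := m₂ - m₁) (by omega)
  have hP3 : pathEdges (fun k => a (m₂ + k)) (n - m₂) = seg a m₂ n := by
    rw [pathEdges_shift, show m₂ + (n - m₂) = n by omega]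
  have hP1 : pathEdges (fun k => a (0 + k)) (m₁ - 0) = seg a 0 m₁ := by
    rw [pathEdges_shift, show 0 + (m₁ - 0) = m₁ by omega]
  have hP2 : pathEdges (fun k => a (m₁ + k)) (m₂ - m₁) = seg a m₁ m₂ := by
    rw [pathEdges_shift, show m₁ + (m₂ - m₁) = m₂ by omega]
  have hE3 : E' ∪ pathEdges a n = (E' ∪ (seg a 0 m₁ ∪ seg a m₁ m₂)) ∪ pathEdges (fun k => a (m₂ + k)) (n - m₂) := by
    rw [hP3, hP]; ac_rfl
  have hE1 : E' ∪ pathEdges a n = (E' ∪ (seg a m₁ m₂ ∪ seg a m₂ n)) ∪ pathEdges (fun k => a (0 + k)) (m₁ - 0) := by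
    rw [hP1, hP]; ac_rfl
  have hE2 : E' ∪ pathEdges a n = ((E' ∪ seg a 0 m₁) ∪ seg a m₂ n) ∪ pathEdges (fun k => a (m₁ + k)) (m₂ - m₁) := by
    rw [hP2, hP]; ac_rfl
  have hp3 : prodU p' (prodU pd1 (prodU pd2 pd3)) = prodU (prodU p' (prodU pd1 pd2)) pd3 := by
    rw [prodU_assoc pd1, prodU_assoc p']
  have hp1 : prodU p' (prodU pd1 (prodU pd2 pd3)) = prodU (prodU p' (prodU pd2 pd3)) pd1 := by
    rw [prodU_comm pd1, prodU_assoc p']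
  have hp2 : prodU p' (prodU pd1 (prodU pd2 pd3)) = prodU (prodU (prodU p' pd1) pd3) pd2 := by
    rw [prodU_comm pd2 pd3, prodU_assoc pd1, prodU_assoc p', prodU_assoc p']
  -- interiors of the pieces avoid the reduced configurations
  have hsupp3 : ∀ k, 0 < k → k < n - m₂ → a (m₂ + k) ∉ supp (E' ∪ (seg a 0 m₁ ∪ seg a m₁ m₂)) := by
    intro k hk1 hk2 h
    rcases mem_supp_union.1 h with h | h
    · exact hint (m₂ + k) (by omega) (by omega) h
    · rcases mem_supp_union.1 h with h | h
      · obtain ⟨k', hk1', hk2', hkk⟩ := exists_index_of_mem_supp_seg (by omega) h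
        have := ha _ _ (by omega) (by omega) hkk; omega
      · obtain ⟨k', hk1', hk2', hkk⟩ := exists_index_of_mem_supp_seg (by omega) h
        have := ha _ _ (by omega) (by omega) hkk; omega
  have hsupp1 : ∀ k, 0 < k → k < m₁ - 0 → a (0 + k) ∉ supp (E' ∪ (seg a m₁ m₂ ∪ seg a m₂ n)) := by
    intro k hk1 hk2 h
    rcases mem_supp_union.1 h with h | h
    · exact hint (0 + k) (by omega) (by omega) h
    · rcases mem_supp_union.1 h with h | h
      · obtain ⟨k', hk1', hk2', hkk⟩ := exists_index_of_mem_supp_seg (by omega) h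
        have := ha _ _ (by omega) (by omega) hkk; omega
      · obtain ⟨k', hk1', hk2', hkk⟩ := exists_index_of_mem_supp_seg (by omega) h
        have := ha _ _ (by omega) (by omega) hkk; omega
  have hsupp2 : ∀ k, 0 < k → k < m₂ - m₁ → a (m₁ + k) ∉ supp ((E' ∪ seg a 0 m₁) ∪ seg a m₂ n) := by
    intro k hk1 hk2 h
    rcases mem_supp_union.1 h with h | h
    · rcases mem_supp_union.1 h with h | h
      · exact hint (m₁ + k) (by omega) (by omega) h
      · obtain ⟨k', hk1', hk2', hkk⟩ := exists_index_of_mem_supp_seg (by omega) h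
        have := ha _ _ (by omega) (by omega) hkk; omega
    · obtain ⟨k', hk1', hk2', hkk⟩ := exists_index_of_mem_supp_seg (by omega) h
      have := ha _ _ (by omega) (by omega) hkk; omega
  -- total mass of the pieces
  have T1 := G1.total; have T2 := G2.total; have T3 := G3.total
  -- per-pair fields: pick a piece whose interior avoids `u` and `v`
  have core : ∀ u v : V,
      (∀ k : ℕ, (gr (E' ∪ pathEdges a n)).edist u v = k → k ≤ L →
        jointProb (prodU p' (prodU pd1 (prodU pd2 pd3))) (E' ∪ pathEdges a n) u v = (1 - μ) ^ k) ∧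
      ((L : ℕ∞) < (gr (E' ∪ pathEdges a n)).edist u v →
        jointProb (prodU p' (prodU pd1 (prodU pd2 pd3))) (E' ∪ pathEdges a n) u v ≤ (1 - μ) ^ L) ∧
      (∀ S, prodU p' (prodU pd1 (prodU pd2 pd3)) S ≠ 0 → (gr (E' ∪ pathEdges a n)).edist u v ≤ L →
        (gr ((E' ∪ pathEdges a n) \ S)).Reachable u v →
        (gr ((E' ∪ pathEdges a n) \ S)).edist u v = (gr (E' ∪ pathEdges a n)).edist u v) := by
    intro u v
    -- interior membership predicates
    by_cases h1 : (∀ k, 0 < k → k < m₁ - 0 → a (0 + k) ≠ u) ∧ (∀ k, 0 < k → k < m₁ - 0 → a (0 + k) ≠ v)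
    · have AF := attach_fields R1 hb1 (by omega) (by omega) hsupp1 T1
        (fun S hS => hP1 ▸ S1 S hS) (fun S hS => by rw [hP1]; exact C1 S hS) h1.1 h1.2
      rw [hE1, hp1]
      refine ⟨AF.1, AF.2.1, fun S hS hd hr => ?_⟩
      obtain ⟨S₀, T, rfl, h₀, hT⟩ := exists_of_prodU_ne_zero hS
      exact AF.2.2 S₀ T h₀ hT hd hr
    by_cases h3 : (∀ k, 0 < k → k < n - m₂ → a (m₂ + k) ≠ u) ∧ (∀ k, 0 < k → k < n - m₂ → a (m₂ + k) ≠ v)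
    · have AF := attach_fields R3 hb3 (by omega) (by omega) hsupp3 T3
        (fun S hS => hP3 ▸ S3 S hS) (fun S hS => by rw [hP3]; exact C3 S hS) h3.1 h3.2
      rw [hE3, hp3]
      refine ⟨AF.1, AF.2.1, fun S hS hd hr => ?_⟩
      obtain ⟨S₀, T, rfl, h₀, hT⟩ := exists_of_prodU_ne_zero hS
      exact AF.2.2 S₀ T h₀ hT hd hr
    -- otherwise `u, v` lie one in piece 1 and one in piece 3, hence outside piece 2
    have h2 : (∀ k, 0 < k → k < m₂ - m₁ → a (m₁ + k) ≠ u) ∧ (∀ k, 0 < k → k < m₂ - m₁ → a (m₁ + k) ≠ v) := by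
      simp only [not_and_or, not_forall, not_not, exists_prop] at h1 h3
      constructor
      · intro k hk1 hk2 hku
        rcases h1 with ⟨k₁, hk₁, hk₁', hu₁⟩ | ⟨k₁, hk₁, hk₁', hv₁⟩
        · have := ha _ _ (by omega) (by omega) (hu₁.trans hku.symm); omega
        · rcases h3 with ⟨k₃, hk₃, hk₃', hu₃⟩ | ⟨k₃, hk₃, hk₃', hv₃⟩
          · have := ha _ _ (by omega) (by omega) (hu₃.trans hku.symm); omega
          · have := ha _ _ (by omega) (by omega) (hv₁.trans hv₃.symm); omega
      · intro k hk1 hk2 hkv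
        rcases h1 with ⟨k₁, hk₁, hk₁', hu₁⟩ | ⟨k₁, hk₁, hk₁', hv₁⟩
        · rcases h3 with ⟨k₃, hk₃, hk₃', hu₃⟩ | ⟨k₃, hk₃, hk₃', hv₃⟩
          · have := ha _ _ (by omega) (by omega) (hu₁.trans hu₃.symm); omega
          · have := ha _ _ (by omega) (by omega) (hv₃.trans hkv.symm); omega
        · have := ha _ _ (by omega) (by omega) (hv₁.trans hkv.symm); omega
    have AF := attach_fields R2 hb2 (by omega) (by omega) hsupp2 T2
      (fun S hS => hP2 ▸ S2 S hS) (fun S hS => by rw [hP2]; exact C2 S hS) h2.1 h2.2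
    rw [hE2, hp2]
    refine ⟨AF.1, AF.2.1, fun S hS hd hr => ?_⟩
    obtain ⟨S₀, T, rfl, h₀, hT⟩ := exists_of_prodU_ne_zero hS
    exact AF.2.2 S₀ T h₀ hT hd hr
  -- assemble
  refine ⟨prodU_nonneg hE'.nonneg (prodU_nonneg G1.nonneg (prodU_nonneg G2.nonneg G3.nonneg)),
    sum_prodU _ _ hE'.total (sum_prodU _ _ T1 (sum_prodU _ _ T2 T3)),
    fun S hS => ?_, fun S hS => ?_, fun u v k hk hkL => (core u v).1 k hk hkL,
    fun S u v hS hd hr => (core u v).2.2 S hS hd hr, fun u v hfar => (core u v).2.1 hfar⟩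
  · -- support
    rw [hp3] at hS
    obtain ⟨S₀, T, rfl, h₀, hT⟩ := exists_of_prodU_ne_zero hS
    rw [hE3]
    exact union_subset_union (R3.subset S₀ h₀) (S3 T hT |>.trans (by rw [hP3]))
  · -- acyclic
    rw [hp3] at hS
    obtain ⟨S₀, T, rfl, h₀, hT⟩ := exists_of_prodU_ne_zero hS
    rw [hE3]
    have hdisj : Disjoint (E' ∪ (seg a 0 m₁ ∪ seg a m₁ m₂)) (pathEdges (fun k => a (m₂ + k)) (n - m₂)) := by
      rw [hP3]
      exact disjoint_union_left.2 ⟨hsegE m₂ n le_rfl,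
        disjoint_union_left.2 ⟨disjoint_seg ha (by omega) le_rfl, disjoint_seg ha le_rfl le_rfl⟩⟩
    rw [union_sdiff_union hdisj (R3.subset S₀ h₀) (hP3 ▸ S3 T hT)]
    exact isAcyclic_attachedPath hb3 (fun k hk1 hk2 h => hsupp3 k hk1 hk2 (supp_mono sdiff_subset h))
      sdiff_subset (by rw [hP3]; exact C3 T hT) (by omega) (R3.acyclic S₀ h₀)

end Ear

/-! ### Theorem 3.3 -/

section Main

/-- **One-point separability of an edge set**: `E = A ⊔ B` with `A, B ≠ ∅` whose supports share at
most the vertex `c` (cases 1–2 of the printed case analysis: "the union of connected components" /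
"`G` has a cut vertex `c`"). [cite: CharikarMakarychevMakarychev2010, §3.1 (p. 15, items 2–3)] -/
def Separable (E : Finset (Sym2 V)) : Prop :=
  ∃ (A B : Finset (Sym2 V)) (c : V), A ∪ B = E ∧ Disjoint A B ∧ A.Nonempty ∧ B.Nonempty ∧
    ∀ x, x ∈ supp A → x ∈ supp B → x = c

/-- **`l`-path decomposability, in the hereditary form consumed by the proof of Theorem 3.3**:
every sub-edge-set `E' ⊆ E` with at least two edges which is NOT a one-point union contains a path
`a_0 … a_n` of length `n ≥ l` (vertices pairwise distinct) whose interior vertices are not covered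
by the other edges of `E'` ("every 2-connected subgraph `H` of `G` contains a path of length `l` such
that every vertex of the path has degree 2 in `H`", Def. 3.2, and item 4 of the case analysis: "the
union of an `l`-path decomposable subgraph and a path of length `l` that do not have common vertices
except for the endpoints of the path").  A non-separable edge set with `≥ 2` edges is `2`-connected,
so Def. 3.2 implies this property; it is recorded in this directly usable form (the random-graph
input of CMM09 Thm 5.3 is to be verified in this form).
[cite: CharikarMakarychevMakarychev2010, Def. 3.2 and the case analysis following it (p. 15–16)] -/
def PathDecomposable (l : ℕ) (E : Finset (Sym2 V)) : Prop :=
  ∀ E' ⊆ E, 2 ≤ E'.card → ¬ Separable E' →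
    ∃ (a : ℕ → V) (n : ℕ), l ≤ n ∧ (∀ i j, i ≤ n → j ≤ n → a i = a j → i = j) ∧
      pathEdges a n ⊆ E' ∧ ∀ k, 0 < k → k < n → a k ∉ supp (E' \ pathEdges a n)

omit [Fintype V] in
/-- Path decomposability is hereditary. [cite: CharikarMakarychevMakarychev2010, Def. 3.2 (p. 15)] -/
theorem PathDecomposable.mono {l : ℕ} {A E : Finset (Sym2 V)} (hAE : A ⊆ E) (h : PathDecomposable l E) :
    PathDecomposable l A := fun E' hE' => h E' (hE'.trans hAE)

omit [Fintype V] in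
/-- A path with `n ≥ 1` edges has an edge. [cite: CharikarMakarychevMakarychev2010, Thm 3.3 proof, case 3 (p. 18)] -/
theorem pathEdges_nonempty {a : ℕ → V} {n : ℕ} (hn : 1 ≤ n) : (pathEdges a n).Nonempty :=
  ⟨_, edge_mem_pathEdges (k := 0) (by omega)⟩

/-- **CMM10 Theorem 3.3 (= CMM09 Theorem 2.4): every loopless `l`-path-decomposable edge set carries
a good multicut distribution with parameters `µ ∈ [0,1]`, `L`, provided `9L ≤ l` and
`(1 − µ)^L ≤ 1/2`** (printed: `L = ⌊l/9⌋`, `µ ≥ 1/L`).  Proof by induction on the number of edges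
along the case analysis: empty / single edge / one-point union (`GoodMulticut.union`) / attached
path (`GoodMulticut.ear`, Lemma 3.4). [cite: CharikarMakarychevMakarychev2010, Thm 3.3 (p. 16) and its proof (p. 17–18)] -/
theorem exists_goodMulticut {μ : ℝ} {L l : ℕ} (hμ0 : 0 ≤ μ) (hμ1 : μ ≤ 1) (hq : (1 - μ) ^ L ≤ 1 / 2)
    (hl : 9 * L ≤ l) (E : Finset (Sym2 V)) (hPD : PathDecomposable l E) (hloop : ∀ e ∈ E, ¬ e.IsDiag) :
    ∃ p : Finset (Sym2 V) → ℝ, GoodMulticut μ L E p := by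
  have hL : 1 ≤ L := L_pos hq
  induction' hN : E.card using Nat.strong_induction_on with N ih generalizing E
  rcases Nat.lt_or_ge N 2 with hN2 | hN2
  · -- zero or one edge
    rcases Nat.lt_or_ge N 1 with hN1 | hN1
    · have hE : E = ∅ := by rw [← Finset.card_eq_zero]; omega
      subst hE
      exact ⟨dirac ∅, GoodMulticut.empty hμ1 L⟩
    · obtain ⟨e, rfl⟩ := Finset.card_eq_one.1 (by omega : E.card = 1)
      induction e using Sym2.ind with
      | h x y =>
        have hxy : x ≠ y := fun h => hloop s(x, y) (mem_singleton_self _) (by subst h; simp)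
        exact ⟨_, GoodMulticut.singleton hμ0 hμ1 L hxy⟩
  · by_cases hsep : Separable E
    · -- cases 1–2: a one-point union
      obtain ⟨A, B, c, hAB, hdisj, hA, hB, hmeet⟩ := hsep
      have hcard : A.card + B.card = N := by rw [← hN, ← hAB, card_union_of_disjoint hdisj]
      have hApos := hA.card_pos
      have hBpos := hB.card_pos
      obtain ⟨pA, hpA⟩ := ih A.card (by omega) A (hPD.mono (hAB ▸ subset_union_left))
        (fun e he => hloop e (hAB ▸ mem_union_left _ he)) rfl
      obtain ⟨pB, hpB⟩ := ih B.card (by omega) B (hPD.mono (hAB ▸ subset_union_right))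
        (fun e he => hloop e (hAB ▸ mem_union_right _ he)) rfl
      refine ⟨prodU pA pB, ?_⟩
      rw [← hAB]
      exact GoodMulticut.union hμ0 hμ1 hdisj hmeet hpA hpB
    · -- case 3: an attached path of length `≥ l ≥ 9L`
      obtain ⟨a, n, hln, ha, hP, hint⟩ := hPD E Subset.rfl (by omega) hsep
      have hn : 9 * L ≤ n := le_trans hl hln
      set H := E \ pathEdges a n with hH
      have hHcard : H.card < N := by
        rw [← hN, hH, card_sdiff_of_subset hP]
        have := (pathEdges_nonempty (a := a) (n := n) (by omega)).card_pos
        have := card_le_card hP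
        omega
      obtain ⟨pH, hpH⟩ := ih H.card hHcard H (hPD.mono sdiff_subset)
        (fun e he => hloop e (sdiff_subset he)) rfl
      refine ⟨prodU pH (prodU (pieceDist a L μ 0 (3 * L)) (prodU (pieceDist a L μ (3 * L) (6 * L))
        (pieceDist a L μ (6 * L) n))), ?_⟩
      have hE : E = H ∪ pathEdges a n := by rw [hH, sdiff_union_of_subset hP]
      rw [hE]
      exact GoodMulticut.ear ha hμ0 hμ1 hq hn hpH hint

end Main


end Multicut

end Literature.Combinatorics.Optimization

end
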